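import Literature.MathematicalPhysics.QuantumFieldTheory.OSPermutedBoost
import Literature.MathematicalPhysics.QuantumLattice.JostPoints
import Literature.MathematicalPhysics.QuantumLattice.WightmanBHWTransport
import Literature.Analysis.Distribution.BoundaryValueLimit
import Mathlib.Analysis.SpecialFunctions.Trigonometric.Bounds
import HarnessLib

/-!
# Local commutativity of the OS boundary values near a space-like pair (the local tube argument)

Topic `Literature/MathematicalPhysics/QuantumFieldTheory`, worker file in the decomposition of
`Literature.MathematicalPhysics.QuantumFieldTheory.OS1973_local` (locality (R3) of the
Osterwalder–Schrader boundary values; Osterwalder–Schrader I (1973), §4.5: symmetric continuation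
to the permuted tubes from (E3), Bargmann–Hall–Wightman, "a theorem in [Jost], p. 83" for the
boundary values). This file proves the **local core**: let `𝔚` be the OS continuation of `𝔖ₙ`
(E1, E3; holomorphic on `𝒯ₙ`; Euclidean restriction `𝔖ₙ`; distributional boundary value `T`),
assume that `𝔚` has polynomial growth at the edge of the tube (`HasEdgeGrowth`, which the
Fourier–Laplace representation supplies, `OSLocality`) and the Bargmann–Hall–Wightman theorem
(`exists_extension_extendedForwardTube`). If at the real configuration `x₀` the difference
`ξ₀ = x₀_{j+1} − x₀_j` satisfies `ξ₀¹ > |ξ₀⁰|` (a space-like vector pointing in the first spatial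
direction; the general space-like case is reduced to this one by a spatial rotation in
`OSLocality`), then there is a neighbourhood `O` of `x₀` such that
`T F = T (F ∘ (j j+1))` for every test function `F` compactly supported in `O`
(`apply_permTest_swap_eq_of_edgeGrowth`).

## The argument

Write `τ = (j j+1)`, `Γ` for the base cone of `𝒯ₙ` (`tubeCone`), `𝔚^τ(z) = 𝔚(z ∘ τ)`. The
permuted distribution `T ∘ (· ∘ τ)` is the boundary value of `𝔚^τ` along the directions `η` with
`η ∘ τ ∈ Γ` (`tendsto_permTest_swap`). Let `B_α = B₁(iα)` be the complex boost of imaginary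
rapidity in the `(0,1)`-plane (`boostC`). For a direction `η₋` with all successive differences a
large multiple `L e₀` of the time axis except the `(j+1)`-st, which is `−ε e₀` (so `η₋ ∘ τ ∈ Γ`),
and for `x` near `x₀`, `t` small, the point `z = x + itη₋` satisfies `B_{ct} z ∈ 𝒯ₙ`: the
imaginary part of the boosted `(j+1)`-st difference is `sin(ct) (ξ¹, ξ⁰, 0, …) + O(t ε)`, which
lies in `V₊` because `ξ¹ > |ξ⁰|`, while the other differences keep imaginary parts
`≈ t L e₀ ∈ V₊`. More precisely this holds for all `z = x + iy` with `y` in an open convex cone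
`Γ̃` (`localCone`) containing `η₋` and a direction `η₊ ∈ Γ`, with margins proportional to `‖y‖`
(`boost_mem_forwardTube_of_mem_localCone`). Consequences: (i) such `z` lie in the extended tube
`𝒯'ₙ`, where the BHW continuation `W` of `𝔚` is holomorphic and `W(z) = W(B z) = 𝔚(B z)`;
(ii) by the edge growth of `𝔚`, `|W(x + iy)| ≤ C |y|^{-r}` on this local tube; (iii) by the
functional equation `𝔚(z ∘ τ) = 𝔚(B z)` on `τ𝒯ₙ ∩ B⁻¹𝒯ₙ` (`apply_perm_eq_apply_boostC`,
`OSPermutedBoost`), `W = 𝔚^τ` at the points `x + itη₋`, and `W = 𝔚` at `x + itη₊`. By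
Hörmander's Theorem 3.1.15 (`tendsto_integral_of_norm_le_inv_pow`, `BoundaryValueLimit`) the
boundary values of `W` as `Γ̃ ∋ y → 0` exist and do not depend on the direction; along `η₊` they
give `T F`, along `η₋` they give `T(F ∘ τ)`. Hence `T F = T (F ∘ τ)`.

## References

* K. Osterwalder, R. Schrader, *Axioms for Euclidean Green's functions*, Comm. Math. Phys. 31
  (1973), §4.5 (p. 97). [OsterwalderSchraderCMP1973]
* R. F. Streater, A. S. Wightman, *PCT, Spin and Statistics, and All That* (1964), §2-4
  (complex Lorentz transformations (2-91), extended tube, BHW Thm. 2-11). [StreaterWightman1964]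
* L. Hörmander, *The Analysis of Linear Partial Differential Operators I*, Thm. 3.1.15.
  [HormanderALPDO1]

## Tree / Mathlib

From the tree: `boostC`, `planeRot`, `tubeInvariant_of_orthochronous` (`OSLorentzInvariance`),
`planeBoostEquiv_mem_properComplexLorentzGroup` (`JostPoints`), `isOpen_extendedForwardTube`
(`WightmanBHWTransport`), `complexifyPoint_rePart_add_imPart` (`WightmanAnalyticContinuation`),
`integral_comp_perm_spaceTime` (`WightmanPermutedTubeLocal`), `tendsto_integral_of_norm_le_inv_pow`
(`BoundaryValueLimit`), `apply_perm_eq_apply_boostC` (`OSPermutedBoost`). The elementary bounds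
`abs_apply_le_norm`, `norm_spaceC_le`, `complexifyPoint_sub'` have verbatim copies in
`Literature.Barriers.QuantumFields.*` (downstream of this directory, hence not importable here).
-/

noncomputable section

open MeasureTheory Filter Complex Set Metric
open _root_.Topology
open scoped SchwartzMap
open Literature.MathematicalPhysics.QuantumLattice Literature.MathematicalPhysics.QuantumFieldTheory
open Literature.Analysis.Distribution

namespace Literature.MathematicalPhysics.QuantumFieldTheory

variable {d n : ℕ}

/-! ### Norm bounds for space-time vectors -/

/-- A component is bounded by the Euclidean norm. [folklore] -/
theorem abs_apply_le_norm (p : SpaceTime d) (μ : Fin (d + 1)) : |p μ| ≤ ‖p‖ := by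
  simpa [Real.norm_eq_abs] using PiLp.norm_apply_le p μ

/-- The spatial part is bounded by the Euclidean norm. [folklore] -/
theorem norm_spaceC_le (p : SpaceTime d) : ‖spaceC d p‖ ≤ ‖p‖ := by
  rw [EuclideanSpace.norm_eq, EuclideanSpace.norm_eq]
  refine Real.sqrt_le_sqrt ?_
  rw [Fin.sum_univ_succ]
  simp only [spaceC_apply]
  have : 0 ≤ ‖p 0‖ ^ 2 := by positivity
  linarith

/-! ### The margin function of the forward cone -/

/-- The **margin** `m(p) = p⁰ − ‖p⃗‖` of a vector with respect to the forward cone: `p ∈ V₊` iff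
`m(p) > 0`; `m` is superadditive and positively homogeneous. [folklore] -/
def coneMargin (p : SpaceTime d) : ℝ := p 0 - ‖spaceC d p‖

/-- `p ∈ V₊ ↔ 0 < m(p)`. [folklore] -/
theorem mem_forwardCone_iff_coneMargin_pos (p : SpaceTime d) :
    p ∈ forwardCone d ↔ 0 < coneMargin p := by
  rw [mem_forwardCone_iff_norm_lt, coneMargin, sub_pos]

/-- Superadditivity of the margin. [folklore] -/
theorem coneMargin_add_ge (p q : SpaceTime d) :
    coneMargin p + coneMargin q ≤ coneMargin (p + q) := by
  simp only [coneMargin, map_add, PiLp.add_apply]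
  have := norm_add_le (spaceC d p) (spaceC d q)
  linarith

/-- Positive homogeneity of the margin. [folklore] -/
theorem coneMargin_smul {c : ℝ} (hc : 0 ≤ c) (p : SpaceTime d) :
    coneMargin (c • p) = c * coneMargin p := by
  simp only [coneMargin, map_smul, PiLp.smul_apply, smul_eq_mul, norm_smul, Real.norm_eq_abs,
    abs_of_nonneg hc]
  ring

/-- The margin is at least `−2‖p‖`. [folklore] -/
theorem neg_two_mul_norm_le_coneMargin (p : SpaceTime d) : -(2 * ‖p‖) ≤ coneMargin p := by
  have h1 := abs_apply_le_norm p 0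
  have h2 := norm_spaceC_le p
  rw [coneMargin]
  have := neg_abs_le (p 0)
  linarith

/-- The margin is at most the norm. [folklore] -/
theorem coneMargin_le_norm (p : SpaceTime d) : coneMargin p ≤ ‖p‖ := by
  have h1 := abs_apply_le_norm p 0
  rw [coneMargin]
  have := le_abs_self (p 0)
  have := norm_nonneg (spaceC d p)
  linarith

/-- The margin is continuous. [folklore] -/
theorem continuous_coneMargin : Continuous (coneMargin : SpaceTime d → ℝ) :=
  (EuclideanSpace.proj (0 : Fin (d + 1))).continuous.sub (spaceC d).continuous.norm

/-- `m(t e₀) = t`. [folklore] -/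
theorem coneMargin_smul_e₀ (t : ℝ) : coneMargin (t • e₀ d) = t := by
  simp only [coneMargin, PiLp.smul_apply, e₀_apply, if_true, smul_eq_mul, mul_one]
  have : spaceC d (t • e₀ d) = 0 := by
    ext i; simp [Fin.succ_ne_zero]
  rw [this, norm_zero, sub_zero]

/-! ### Real configurations and complex points -/

/-! The decomposition `z = Re z + i Im z` is the tree's `QuantumLattice.complexifyPoint_rePart_add_imPart`
(`WightmanAnalyticContinuation`). -/

/-- The ray point `x + i t η` is `x + i (t η)`. [folklore] -/
theorem ray_eq_add_I_smul (x η : SpaceTime d) (t : ℝ) :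
    complexifyPoint x + ((t : ℂ) * I) • complexifyPoint η =
      complexifyPoint x + (I : ℂ) • complexifyPoint (t • η) := by
  funext μ
  simp only [Pi.add_apply, Pi.smul_apply, complexifyPoint_apply, smul_eq_mul, PiLp.smul_apply]
  push_cast
  ring

/-- Real and imaginary parts of `a + i b` for real `a`, `b`. [folklore] -/
theorem rePart_add_I_smul (a b : SpaceTime d) :
    rePart (complexifyPoint a + (I : ℂ) • complexifyPoint b) = a := by
  ext μ; simp

/-- Real and imaginary parts of `a + i b` for real `a`, `b`. [folklore] -/
theorem imPart_add_I_smul (a b : SpaceTime d) :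
    imPart (complexifyPoint a + (I : ℂ) • complexifyPoint b) = b := by
  ext μ; simp

/-! ### The imaginary boost of `a + i b`: real and imaginary parts -/

section BoostParts

variable (i : Fin d) (α : ℝ) (a b : SpaceTime d)

/-- **Imaginary part of `B_i(iα)(a + ib)`** (`cosh iα = cos α`, `sinh iα = i sin α`): time
component `cos α b⁰ + sin α aⁱ`, `i`-th spatial component `sin α a⁰ + cos α bⁱ`, the other
components those of `b`. [folklore] -/
theorem imPart_boostC_add_I_smul :
    imPart (boostC i ((α : ℂ) * I) (complexifyPoint a + (I : ℂ) • complexifyPoint b)) =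
      b + ((Real.cos α - 1) * b 0 + Real.sin α * a i.succ) • e₀ d +
        (Real.sin α * a 0 + (Real.cos α - 1) * b i.succ) • EuclideanSpace.single i.succ (1 : ℝ) := by
  ext j
  simp only [imPart_apply, boostC, Complex.cosh_mul_I, Complex.sinh_mul_I, ← Complex.ofReal_cos,
    ← Complex.ofReal_sin, PiLp.add_apply, PiLp.smul_apply, e₀_apply, PiLp.single_apply,
    smul_eq_mul, Pi.add_apply, Pi.smul_apply, complexifyPoint_apply]
  by_cases hj : j = 0
  · subst hj
    simp only [if_true, if_false, (Fin.succ_ne_zero i).symm]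
    simp [Complex.add_im, Complex.mul_im, Complex.mul_re, Complex.cos_ofReal_re,
      Complex.sin_ofReal_re, Complex.cos_ofReal_im, Complex.sin_ofReal_im]
    ring
  · simp only [hj, if_false]
    by_cases hji : j = i.succ
    · subst hji
      simp only [if_true]
      simp [Complex.add_im, Complex.mul_im, Complex.mul_re, Complex.cos_ofReal_re,
        Complex.sin_ofReal_re, Complex.cos_ofReal_im, Complex.sin_ofReal_im]
      ring
    · simp only [hji, if_false]
      simp

/-- **Real part of `B_i(iα)(a + ib)`**: time component `cos α a⁰ − sin α bⁱ`, `i`-th spatial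
component `cos α aⁱ − sin α b⁰`, the other components those of `a`. [folklore] -/
theorem rePart_boostC_add_I_smul :
    rePart (boostC i ((α : ℂ) * I) (complexifyPoint a + (I : ℂ) • complexifyPoint b)) =
      a + ((Real.cos α - 1) * a 0 - Real.sin α * b i.succ) • e₀ d +
        ((Real.cos α - 1) * a i.succ - Real.sin α * b 0) • EuclideanSpace.single i.succ (1 : ℝ) := by
  ext j
  simp only [rePart_apply, boostC, Complex.cosh_mul_I, Complex.sinh_mul_I, ← Complex.ofReal_cos,
    ← Complex.ofReal_sin, PiLp.add_apply, PiLp.smul_apply, e₀_apply, PiLp.single_apply,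
    smul_eq_mul, Pi.add_apply, Pi.smul_apply, complexifyPoint_apply]
  by_cases hj : j = 0
  · subst hj
    simp only [if_true, if_false, (Fin.succ_ne_zero i).symm]
    simp [Complex.add_re, Complex.mul_im, Complex.mul_re, Complex.cos_ofReal_re,
      Complex.sin_ofReal_re, Complex.cos_ofReal_im, Complex.sin_ofReal_im]
    ring
  · simp only [hj, if_false]
    by_cases hji : j = i.succ
    · subst hji
      simp only [if_true]
      simp [Complex.add_re, Complex.mul_im, Complex.mul_re, Complex.cos_ofReal_re,
        Complex.sin_ofReal_re, Complex.cos_ofReal_im, Complex.sin_ofReal_im]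
      ring
    · simp only [hji, if_false]
      simp

end BoostParts


/-! ### Margin and norm estimates for the imaginary boost -/

section BoostEstimates

variable (i : Fin d)

/-- `0 ≤ 1 − cos α ≤ α²/2`, `0 ≤ sin α ≤ α` and `α/2 ≤ sin α` for `0 ≤ α ≤ 1`. [folklore] -/
theorem trig_bounds {α : ℝ} (hα0 : 0 ≤ α) (hα1 : α ≤ 1) :
    0 ≤ 1 - Real.cos α ∧ 1 - Real.cos α ≤ α ^ 2 / 2 ∧ 0 ≤ Real.sin α ∧ Real.sin α ≤ α ∧
      α / 2 ≤ Real.sin α := by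
  have hπ := Real.pi_gt_three
  have hπ4 := Real.pi_le_four
  refine ⟨by linarith [Real.cos_le_one α], by linarith [Real.one_sub_sq_div_two_le_cos (x := α)],
    Real.sin_nonneg_of_nonneg_of_le_pi hα0 (by linarith), Real.sin_le hα0, ?_⟩
  have h := Real.mul_le_sin hα0 (by linarith)
  have h2 : α / 2 ≤ 2 / Real.pi * α := by
    rw [div_mul_eq_mul_div, le_div_iff₀ (by linarith)]
    nlinarith
  linarith

/-- **Margin of the boosted imaginary part**: for `0 ≤ α ≤ 1`,
`m(Im B_i(iα)(a + ib)) ≥ m(b) − α² ‖b‖ + sin α (aⁱ − |a⁰|)`. [folklore] -/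
theorem coneMargin_imPart_boostC_ge {α : ℝ} (hα0 : 0 ≤ α) (hα1 : α ≤ 1) (a b : SpaceTime d) :
    coneMargin b - α ^ 2 * ‖b‖ + Real.sin α * (a i.succ - |a 0|) ≤
      coneMargin (imPart (boostC i ((α : ℂ) * I)
        (complexifyPoint a + (I : ℂ) • complexifyPoint b))) := by
  obtain ⟨hc0, hc2, hs0, -, -⟩ := trig_bounds hα0 hα1
  rw [imPart_boostC_add_I_smul]
  set c₁ : ℝ := (Real.cos α - 1) * b 0 + Real.sin α * a i.succ with hc₁
  set c₂ : ℝ := Real.sin α * a 0 + (Real.cos α - 1) * b i.succ with hc₂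
  set p : SpaceTime d := b + c₁ • e₀ d + c₂ • EuclideanSpace.single i.succ (1 : ℝ) with hp
  have hp0 : p 0 = b 0 + c₁ := by
    simp [hp, (Fin.succ_ne_zero i).symm]
  have hsp : spaceC d p = spaceC d b + c₂ • EuclideanSpace.single i (1 : ℝ) := by
    ext m
    simp only [hp, map_add, map_smul, PiLp.add_apply, PiLp.smul_apply, spaceC_apply, e₀_apply,
      Fin.succ_ne_zero, if_false, smul_eq_mul, mul_zero, add_zero, PiLp.single_apply,
      Fin.succ_inj]
  have hnsp : ‖spaceC d p‖ ≤ ‖spaceC d b‖ + |c₂| := by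
    rw [hsp]
    calc ‖spaceC d b + c₂ • EuclideanSpace.single i (1 : ℝ)‖
        ≤ ‖spaceC d b‖ + ‖c₂ • EuclideanSpace.single i (1 : ℝ)‖ := norm_add_le _ _
      _ = ‖spaceC d b‖ + |c₂| := by
          rw [norm_smul, PiLp.norm_single, Real.norm_eq_abs, norm_one, mul_one]
  have hb0 : |b 0| ≤ ‖b‖ := abs_apply_le_norm b 0
  have hbi : |b i.succ| ≤ ‖b‖ := abs_apply_le_norm b i.succ
  have hc₁_ge : -(1 - Real.cos α) * |b 0| + Real.sin α * a i.succ ≤ c₁ := by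
    rw [hc₁]
    have : (Real.cos α - 1) * b 0 ≥ -(1 - Real.cos α) * |b 0| := by
      have h1 : -|b 0| ≤ b 0 := neg_abs_le _
      have h2 : b 0 ≤ |b 0| := le_abs_self _
      nlinarith
    linarith
  have hc₂_le : |c₂| ≤ Real.sin α * |a 0| + (1 - Real.cos α) * |b i.succ| := by
    rw [hc₂]
    calc |Real.sin α * a 0 + (Real.cos α - 1) * b i.succ|
        ≤ |Real.sin α * a 0| + |(Real.cos α - 1) * b i.succ| := abs_add_le _ _
      _ = Real.sin α * |a 0| + (1 - Real.cos α) * |b i.succ| := by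
          rw [abs_mul, abs_mul, abs_of_nonneg hs0, show |Real.cos α - 1| = 1 - Real.cos α by
            rw [abs_sub_comm]; exact abs_of_nonneg hc0]
  have key : coneMargin p = p 0 - ‖spaceC d p‖ := rfl
  rw [key, hp0]
  have hb' : coneMargin b = b 0 - ‖spaceC d b‖ := rfl
  rw [hb']
  nlinarith [hnsp, hc₁_ge, hc₂_le, hb0, hbi, sq_nonneg α, norm_nonneg b,
    mul_nonneg hc0 (abs_nonneg (b 0)), mul_nonneg hc0 (abs_nonneg (b i.succ))]

/-- **Norm of the boosted imaginary part**: for `0 ≤ α ≤ 1`,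
`‖Im B_i(iα)(a + ib)‖ ≤ 3‖b‖ + 2α‖a‖`. [folklore] -/
theorem norm_imPart_boostC_le {α : ℝ} (hα0 : 0 ≤ α) (hα1 : α ≤ 1) (a b : SpaceTime d) :
    ‖imPart (boostC i ((α : ℂ) * I) (complexifyPoint a + (I : ℂ) • complexifyPoint b))‖ ≤
      3 * ‖b‖ + 2 * α * ‖a‖ := by
  obtain ⟨hc0, hc2, hs0, hs1, -⟩ := trig_bounds hα0 hα1
  rw [imPart_boostC_add_I_smul]
  have hb0 : |b 0| ≤ ‖b‖ := abs_apply_le_norm b 0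
  have hbi : |b i.succ| ≤ ‖b‖ := abs_apply_le_norm b i.succ
  have ha0 : |a 0| ≤ ‖a‖ := abs_apply_le_norm a 0
  have hai : |a i.succ| ≤ ‖a‖ := abs_apply_le_norm a i.succ
  have hcos1 : 1 - Real.cos α ≤ 1 := by nlinarith
  have h1 : |(Real.cos α - 1) * b 0 + Real.sin α * a i.succ| ≤ ‖b‖ + α * ‖a‖ := by
    calc |(Real.cos α - 1) * b 0 + Real.sin α * a i.succ|
        ≤ |(Real.cos α - 1) * b 0| + |Real.sin α * a i.succ| := abs_add_le _ _
      _ = (1 - Real.cos α) * |b 0| + Real.sin α * |a i.succ| := by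
          rw [abs_mul, abs_mul, abs_of_nonneg hs0, show |Real.cos α - 1| = 1 - Real.cos α by
            rw [abs_sub_comm]; exact abs_of_nonneg hc0]
      _ ≤ 1 * ‖b‖ + α * ‖a‖ := by gcongr
      _ = ‖b‖ + α * ‖a‖ := by ring
  have h2 : |Real.sin α * a 0 + (Real.cos α - 1) * b i.succ| ≤ α * ‖a‖ + ‖b‖ := by
    calc |Real.sin α * a 0 + (Real.cos α - 1) * b i.succ|
        ≤ |Real.sin α * a 0| + |(Real.cos α - 1) * b i.succ| := abs_add_le _ _
      _ = Real.sin α * |a 0| + (1 - Real.cos α) * |b i.succ| := by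
          rw [abs_mul, abs_mul, abs_of_nonneg hs0, show |Real.cos α - 1| = 1 - Real.cos α by
            rw [abs_sub_comm]; exact abs_of_nonneg hc0]
      _ ≤ α * ‖a‖ + 1 * ‖b‖ := by gcongr
      _ = α * ‖a‖ + ‖b‖ := by ring
  calc ‖b + ((Real.cos α - 1) * b 0 + Real.sin α * a i.succ) • e₀ d +
        (Real.sin α * a 0 + (Real.cos α - 1) * b i.succ) • EuclideanSpace.single i.succ (1 : ℝ)‖
      ≤ ‖b‖ + ‖((Real.cos α - 1) * b 0 + Real.sin α * a i.succ) • e₀ d‖ +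
          ‖(Real.sin α * a 0 + (Real.cos α - 1) * b i.succ) • EuclideanSpace.single i.succ (1 : ℝ)‖ :=
        norm_add₃_le
    _ = ‖b‖ + |(Real.cos α - 1) * b 0 + Real.sin α * a i.succ| +
          |Real.sin α * a 0 + (Real.cos α - 1) * b i.succ| := by
        rw [norm_smul, norm_smul, Real.norm_eq_abs, Real.norm_eq_abs, e₀,
          PiLp.norm_single, PiLp.norm_single, norm_one, mul_one, mul_one]
    _ ≤ 3 * ‖b‖ + 2 * α * ‖a‖ := by linarith

/-- **Norm of the boosted real part**: for `0 ≤ α ≤ 1`, `‖Re B_i(iα)(a + ib)‖ ≤ 3‖a‖ + 2‖b‖`.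
[folklore] -/
theorem norm_rePart_boostC_le {α : ℝ} (hα0 : 0 ≤ α) (hα1 : α ≤ 1) (a b : SpaceTime d) :
    ‖rePart (boostC i ((α : ℂ) * I) (complexifyPoint a + (I : ℂ) • complexifyPoint b))‖ ≤
      3 * ‖a‖ + 2 * ‖b‖ := by
  obtain ⟨hc0, hc2, hs0, hs1, -⟩ := trig_bounds hα0 hα1
  rw [rePart_boostC_add_I_smul]
  have hb0 : |b 0| ≤ ‖b‖ := abs_apply_le_norm b 0
  have hbi : |b i.succ| ≤ ‖b‖ := abs_apply_le_norm b i.succ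
  have ha0 : |a 0| ≤ ‖a‖ := abs_apply_le_norm a 0
  have hai : |a i.succ| ≤ ‖a‖ := abs_apply_le_norm a i.succ
  have hcos1 : 1 - Real.cos α ≤ 1 := by nlinarith
  have hsin1 : Real.sin α ≤ 1 := by linarith
  have h1 : |(Real.cos α - 1) * a 0 - Real.sin α * b i.succ| ≤ ‖a‖ + ‖b‖ := by
    calc |(Real.cos α - 1) * a 0 - Real.sin α * b i.succ|
        ≤ |(Real.cos α - 1) * a 0| + |Real.sin α * b i.succ| := abs_sub _ _
      _ = (1 - Real.cos α) * |a 0| + Real.sin α * |b i.succ| := by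
          rw [abs_mul, abs_mul, abs_of_nonneg hs0, show |Real.cos α - 1| = 1 - Real.cos α by
            rw [abs_sub_comm]; exact abs_of_nonneg hc0]
      _ ≤ 1 * ‖a‖ + 1 * ‖b‖ := by gcongr
      _ = ‖a‖ + ‖b‖ := by ring
  have h2 : |(Real.cos α - 1) * a i.succ - Real.sin α * b 0| ≤ ‖a‖ + ‖b‖ := by
    calc |(Real.cos α - 1) * a i.succ - Real.sin α * b 0|
        ≤ |(Real.cos α - 1) * a i.succ| + |Real.sin α * b 0| := abs_sub _ _
      _ = (1 - Real.cos α) * |a i.succ| + Real.sin α * |b 0| := by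
          rw [abs_mul, abs_mul, abs_of_nonneg hs0, show |Real.cos α - 1| = 1 - Real.cos α by
            rw [abs_sub_comm]; exact abs_of_nonneg hc0]
      _ ≤ 1 * ‖a‖ + 1 * ‖b‖ := by gcongr
      _ = ‖a‖ + ‖b‖ := by ring
  calc ‖a + ((Real.cos α - 1) * a 0 - Real.sin α * b i.succ) • e₀ d +
        ((Real.cos α - 1) * a i.succ - Real.sin α * b 0) • EuclideanSpace.single i.succ (1 : ℝ)‖
      ≤ ‖a‖ + ‖((Real.cos α - 1) * a 0 - Real.sin α * b i.succ) • e₀ d‖ +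
          ‖((Real.cos α - 1) * a i.succ - Real.sin α * b 0) • EuclideanSpace.single i.succ (1 : ℝ)‖ :=
        norm_add₃_le
    _ = ‖a‖ + |(Real.cos α - 1) * a 0 - Real.sin α * b i.succ| +
          |(Real.cos α - 1) * a i.succ - Real.sin α * b 0| := by
        rw [norm_smul, norm_smul, Real.norm_eq_abs, Real.norm_eq_abs, e₀,
          PiLp.norm_single, PiLp.norm_single, norm_one, mul_one, mul_one]
    _ ≤ 3 * ‖a‖ + 2 * ‖b‖ := by linarith

/-- **Margin estimate away from the swapped pair**: if `m(b) > κ₁ ν`, `‖b‖ ≤ 2ν`, `‖a‖ ≤ A`,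
`ν ≤ γ ≤ 1`, `2γ ≤ κ₁/4`, `2cA ≤ κ₁/4`, `0 ≤ c ≤ 1`, then the boost of rapidity `i c ν` keeps the
margin `≥ κ₁ ν / 2`. [folklore] -/
theorem margin_far {κ₁ c A γ ν : ℝ} (hc0 : 0 ≤ c) (hc1 : c ≤ 1) (hA : 0 ≤ A)
    (hcA : 2 * c * A ≤ κ₁ / 4) (hγ1 : γ ≤ 1) (hγκ : 2 * γ ≤ κ₁ / 4) (hν0 : 0 ≤ ν) (hνγ : ν ≤ γ)
    {a b : SpaceTime d} (ha : ‖a‖ ≤ A) (hb : ‖b‖ ≤ 2 * ν) (hm : κ₁ * ν ≤ coneMargin b) :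
    κ₁ * ν / 2 ≤ coneMargin (imPart (boostC i (((c * ν : ℝ) : ℂ) * I)
      (complexifyPoint a + (I : ℂ) • complexifyPoint b))) := by
  have hα0 : 0 ≤ c * ν := mul_nonneg hc0 hν0
  have hν1 : ν ≤ 1 := hνγ.trans hγ1
  have hα1 : c * ν ≤ 1 := by nlinarith
  obtain ⟨-, -, hs0, hs1, -⟩ := trig_bounds hα0 hα1
  have key := coneMargin_imPart_boostC_ge i hα0 hα1 a b
  have ha0 : |a 0| ≤ ‖a‖ := abs_apply_le_norm a 0
  have hai : |a i.succ| ≤ ‖a‖ := abs_apply_le_norm a i.succ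
  have h1 : -(2 * A) ≤ a i.succ - |a 0| := by
    have := neg_abs_le (a i.succ); linarith
  have h2 : Real.sin (c * ν) * (a i.succ - |a 0|) ≥ -(c * ν) * (2 * A) := by
    nlinarith
  have h3 : (c * ν) ^ 2 * ‖b‖ ≤ ν * (2 * γ) := by
    have hc2 : c ^ 2 ≤ 1 := by nlinarith
    have hsq : (c * ν) ^ 2 ≤ ν * γ :=
      calc (c * ν) ^ 2 = c ^ 2 * ν ^ 2 := by ring
        _ ≤ 1 * ν ^ 2 := mul_le_mul_of_nonneg_right hc2 (sq_nonneg ν)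
        _ = ν * ν := by ring
        _ ≤ ν * γ := mul_le_mul_of_nonneg_left hνγ hν0
    have hνγ0 : 0 ≤ ν * γ := mul_nonneg hν0 (hν0.trans hνγ)
    calc (c * ν) ^ 2 * ‖b‖ ≤ (ν * γ) * (2 * ν) := mul_le_mul hsq hb (norm_nonneg b) hνγ0
      _ = ν * (2 * γ) * ν := by ring
      _ ≤ ν * (2 * γ) * 1 := by
          refine mul_le_mul_of_nonneg_left hν1 ?_
          nlinarith
      _ = ν * (2 * γ) := by ring
  nlinarith

/-- **Margin estimate at the swapped pair**: if `ξⁱ − |ξ⁰| ≥ μ₀/2`, `‖b‖ ≤ 2κ₂ ν` with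
`κ₂ = cμ₀/48`, `0 ≤ c`, `c ν ≤ 1`, then the boost of rapidity `i c ν` produces the margin
`≥ c μ₀ ν / 8`. [folklore] -/
theorem margin_near {c μ₀ ν : ℝ} (hc0 : 0 ≤ c) (hμ₀ : 0 ≤ μ₀) (hν0 : 0 ≤ ν) (hα1 : c * ν ≤ 1)
    {ξ b : SpaceTime d} (hξ : μ₀ / 2 ≤ ξ i.succ - |ξ 0|) (hb : ‖b‖ ≤ 2 * (c * μ₀ / 48) * ν) :
    c * μ₀ * ν / 8 ≤ coneMargin (imPart (boostC i (((c * ν : ℝ) : ℂ) * I)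
      (complexifyPoint ξ + (I : ℂ) • complexifyPoint b))) := by
  have hα0 : 0 ≤ c * ν := mul_nonneg hc0 hν0
  obtain ⟨-, -, hs0, hs1, hs2⟩ := trig_bounds hα0 hα1
  have key := coneMargin_imPart_boostC_ge i hα0 hα1 ξ b
  have hmb : -(2 * ‖b‖) ≤ coneMargin b := neg_two_mul_norm_le_coneMargin b
  have h1 : (c * ν) ^ 2 * ‖b‖ ≤ ‖b‖ := by
    have : (c * ν) ^ 2 ≤ 1 := by nlinarith
    nlinarith [norm_nonneg b]
  have h2 : c * ν / 2 * (μ₀ / 2) ≤ Real.sin (c * ν) * (ξ i.succ - |ξ 0|) := by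
    have hpos : 0 ≤ ξ i.succ - |ξ 0| := by linarith
    exact mul_le_mul hs2 hξ (by linarith) hs0
  nlinarith [norm_nonneg b]

end BoostEstimates

/-! ### Successive differences of boosted configurations -/

/-- The complex boost is compatible with subtraction. [folklore] -/
theorem boostC_sub_arg (i : Fin d) (w : ℂ) (a b : Fin (d + 1) → ℂ) :
    boostC i w (a - b) = boostC i w a - boostC i w b := by
  rw [sub_eq_add_neg, boostC_add_arg, ← neg_one_smul ℂ b, boostC_smul_arg, neg_one_smul,
    ← sub_eq_add_neg]

/-- Successive differences of a boosted configuration are the boosted successive differences.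
[folklore] -/
theorem succDiff_boostConfig (i : Fin d) (w : ℂ) (z : Fin n → Fin (d + 1) → ℂ) (k : Fin n) :
    succDiff (boostConfig n i w z) k = boostC i w (succDiff z k) :=
  succDiff_map (boostC i w) (boostC_sub_arg i w) z k

/-- `complexifyPoint` is compatible with subtraction. [folklore] -/
theorem complexifyPoint_sub' (a b : SpaceTime d) :
    complexifyPoint (a - b) = complexifyPoint a - complexifyPoint b := by
  funext μ; simp

/-- Successive differences of `x + iy` are `(x_k − x_{k-1}) + i(y_k − y_{k-1})`. [folklore] -/
theorem succDiff_add_I_smul (x y : Fin n → SpaceTime d) (k : Fin n) :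
    succDiff (fun k => complexifyPoint (x k) + (I : ℂ) • complexifyPoint (y k)) k =
      complexifyPoint (succDiff x k) + (I : ℂ) • complexifyPoint (succDiff y k) := by
  have h := succDiff_add (fun k => complexifyPoint (x k)) (fun k => (I : ℂ) • complexifyPoint (y k)) k
  rw [show (fun k => complexifyPoint (x k) + (I : ℂ) • complexifyPoint (y k)) =
      (fun k => complexifyPoint (x k)) + fun k => (I : ℂ) • complexifyPoint (y k) from rfl, h,
    succDiff_map complexifyPoint complexifyPoint_sub' x k,
    succDiff_map (fun v => (I : ℂ) • complexifyPoint v) (fun a b => by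
      rw [complexifyPoint_sub', smul_sub]) y k]

/-- The norm of a successive difference is at most twice the (sup) norm of the configuration.
[folklore] -/
theorem norm_succDiff_le (x : Fin n → SpaceTime d) (k : Fin n) : ‖succDiff x k‖ ≤ 2 * ‖x‖ := by
  have hk : ‖x k‖ ≤ ‖x‖ := norm_le_pi_norm x k
  cases n with
  | zero => exact k.elim0
  | succ m =>
    refine Fin.cases ?_ (fun j => ?_) k
    · rw [succDiff_zero]
      have := norm_le_pi_norm x 0
      linarith [norm_nonneg x]
    · rw [succDiff_succ]
      calc ‖x j.succ - x j.castSucc‖ ≤ ‖x j.succ‖ + ‖x j.castSucc‖ := norm_sub_le _ _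
        _ ≤ ‖x‖ + ‖x‖ := add_le_add (norm_le_pi_norm x _) (norm_le_pi_norm x _)
        _ = 2 * ‖x‖ := by ring

/-! ### The local cone of directions -/

variable (n) in
/-- **The local cone** `Γ̃` of imaginary directions attached to the swapped index `j'` (with a
reference index `jr ≠ j'`): all successive differences other than the `j'`-th lie in `V₊` with
margin `> κ₁ ‖y‖`, and the `j'`-th is small, `‖y_{j'} − y_{j'-1}‖ < κ₂ m(y_{jr} − y_{jr-1})`.
It is an open convex cone not containing `0`, it meets the base cone `Γ` of `𝒯ₙ` (directions
with `j'`-th difference `+ε e₀`) and the permuted base cone (directions with `j'`-th difference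
`−ε e₀`). [folklore] -/
def localCone (j' jr : Fin n) (κ₁ κ₂ : ℝ) : Set (Fin n → SpaceTime d) :=
  {y | (∀ k, k ≠ j' → κ₁ * ‖y‖ < coneMargin (succDiff y k)) ∧
    ‖succDiff y j'‖ < κ₂ * coneMargin (succDiff y jr)}

section LocalCone

variable {j' jr : Fin n} {κ₁ κ₂ : ℝ}

/-- Continuity of `y ↦ y_k − y_{k-1}`. [folklore] -/
theorem continuous_succDiff (k : Fin n) :
    Continuous fun y : Fin n → SpaceTime d => succDiff y k := by
  cases n with
  | zero => exact k.elim0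
  | succ m =>
    refine Fin.cases ?_ (fun j => ?_) k
    · simp only [succDiff_zero]; exact continuous_apply _
    · simp only [succDiff_succ]; exact (continuous_apply _).sub (continuous_apply _)

/-- The local cone is open. [folklore] -/
theorem isOpen_localCone : IsOpen (localCone n j' jr κ₁ κ₂ : Set (Fin n → SpaceTime d)) := by
  have hm : ∀ k : Fin n, Continuous fun y : Fin n → SpaceTime d => coneMargin (succDiff y k) :=
    fun k => continuous_coneMargin.comp (continuous_succDiff k)
  have h1 : IsOpen {y : Fin n → SpaceTime d |
      ∀ k, k ≠ j' → κ₁ * ‖y‖ < coneMargin (succDiff y k)} := by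
    rw [Set.setOf_forall]
    refine isOpen_iInter_of_finite fun k => ?_
    by_cases hk : k = j'
    · have : {y : Fin n → SpaceTime d | k ≠ j' → κ₁ * ‖y‖ < coneMargin (succDiff y k)} =
          Set.univ := by
        ext y; simp [hk]
      rw [this]; exact isOpen_univ
    · have : {y : Fin n → SpaceTime d | k ≠ j' → κ₁ * ‖y‖ < coneMargin (succDiff y k)} =
          {y | κ₁ * ‖y‖ < coneMargin (succDiff y k)} := by
        ext y; simp [hk]
      rw [this]; exact isOpen_lt (continuous_const.mul continuous_norm) (hm k)
  have h2 : IsOpen {y : Fin n → SpaceTime d |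
      ‖succDiff y j'‖ < κ₂ * coneMargin (succDiff y jr)} :=
    isOpen_lt (continuous_succDiff j').norm (continuous_const.mul (hm jr))
  exact h1.inter h2

/-- The local cone is stable under positive scaling. [folklore] -/
theorem smul_mem_localCone {y : Fin n → SpaceTime d} (hy : y ∈ localCone n j' jr κ₁ κ₂) {c : ℝ}
    (hc : 0 < c) : c • y ∈ localCone n j' jr κ₁ κ₂ := by
  have hsd : ∀ k, succDiff (c • y) k = c • succDiff y k := fun k => succDiff_smul c y k
  refine ⟨fun k hk => ?_, ?_⟩
  · rw [hsd, coneMargin_smul hc.le, norm_smul, Real.norm_eq_abs, abs_of_pos hc]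
    have := hy.1 k hk
    nlinarith
  · rw [hsd, hsd, coneMargin_smul hc.le, norm_smul, Real.norm_eq_abs, abs_of_pos hc]
    have := hy.2
    nlinarith

/-- The local cone is convex (the margin is concave, the norm convex). [folklore] -/
theorem convex_localCone (hκ₁ : 0 ≤ κ₁) (hκ₂ : 0 ≤ κ₂) :
    Convex ℝ (localCone n j' jr κ₁ κ₂ : Set (Fin n → SpaceTime d)) := by
  intro y hy y' hy' s t hs ht hst
  have hsd : ∀ k, succDiff (s • y + t • y') k = s • succDiff y k + t • succDiff y' k := fun k => by
    rw [succDiff_add, succDiff_smul, succDiff_smul]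
  have hmarg : ∀ k, s * coneMargin (succDiff y k) + t * coneMargin (succDiff y' k) ≤
      coneMargin (succDiff (s • y + t • y') k) := fun k => by
    rw [hsd, ← coneMargin_smul hs, ← coneMargin_smul ht]
    exact coneMargin_add_ge _ _
  have hnorm : ‖s • y + t • y'‖ ≤ s * ‖y‖ + t * ‖y'‖ := by
    calc ‖s • y + t • y'‖ ≤ ‖s • y‖ + ‖t • y'‖ := norm_add_le _ _
      _ = s * ‖y‖ + t * ‖y'‖ := by
        rw [norm_smul, norm_smul, Real.norm_eq_abs, Real.norm_eq_abs, abs_of_nonneg hs,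
          abs_of_nonneg ht]
  refine ⟨fun k hk => ?_, ?_⟩
  · have h1 := hy.1 k hk
    have h2 := hy'.1 k hk
    have := hmarg k
    rcases hs.eq_or_lt with rfl | hs'
    · rw [zero_add] at hst; subst hst; simpa using h2
    · nlinarith [norm_nonneg y, norm_nonneg y']
  · have h1 := hy.2
    have h2 := hy'.2
    have hm := hmarg jr
    have hn : ‖succDiff (s • y + t • y') j'‖ ≤ s * ‖succDiff y j'‖ + t * ‖succDiff y' j'‖ := by
      rw [hsd]
      calc ‖s • succDiff y j' + t • succDiff y' j'‖ ≤ ‖s • succDiff y j'‖ + ‖t • succDiff y' j'‖ :=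
            norm_add_le _ _
        _ = s * ‖succDiff y j'‖ + t * ‖succDiff y' j'‖ := by
          rw [norm_smul, norm_smul, Real.norm_eq_abs, Real.norm_eq_abs, abs_of_nonneg hs,
            abs_of_nonneg ht]
    rcases hs.eq_or_lt with rfl | hs'
    · rw [zero_add] at hst; subst hst; simpa using h2
    · nlinarith [norm_nonneg (succDiff y j'), norm_nonneg (succDiff y' j')]

/-- `0` is not in the local cone (as soon as `jr ≠ j'`). [folklore] -/
theorem zero_notMem_localCone (hjr : jr ≠ j') :
    (0 : Fin n → SpaceTime d) ∉ localCone n j' jr κ₁ κ₂ := by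
  intro h
  have := h.1 jr hjr
  have h0 : succDiff (0 : Fin n → SpaceTime d) jr = 0 := by
    have := succDiff_smul (0 : ℝ) (0 : Fin n → SpaceTime d) jr
    simpa using this
  rw [h0] at this
  simp [coneMargin] at this

/-- On the local cone every successive difference other than the `j'`-th has margin `> κ₁‖y‖`
and norm `≤ 2‖y‖`, and the `j'`-th has norm `< 2κ₂‖y‖`. [folklore] -/
theorem norm_succDiff_lt_of_mem_localCone (hκ₂ : 0 ≤ κ₂) {y : Fin n → SpaceTime d}
    (hy : y ∈ localCone n j' jr κ₁ κ₂) : ‖succDiff y j'‖ ≤ 2 * κ₂ * ‖y‖ := by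
  have h := hy.2
  have hm : coneMargin (succDiff y jr) ≤ 2 * ‖y‖ :=
    (coneMargin_le_norm _).trans (norm_succDiff_le y jr)
  nlinarith

end LocalCone


/-! ### The two directions `η₊ ∈ Γ` and `η₋` with `η₋ ∘ τ ∈ Γ` -/

variable (d n) in
/-- The direction `η(L, δ)`: purely time-like imaginary parts `s_k e₀` with successive differences
`L e₀` except the `j'`-th, which is `δ e₀` (`s_k = L (k+1) + (δ − L) [j' ≤ k]`). [folklore] -/
def etaDir (j' : Fin n) (L δ : ℝ) : Fin n → SpaceTime d :=
  fun k => (L * ((k : ℕ) + 1 : ℝ) + (δ - L) * (if (j' : ℕ) ≤ (k : ℕ) then 1 else 0)) • e₀ d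

/-- Successive differences of `η(L, δ)`: `δ e₀` at `j'`, `L e₀` elsewhere. [folklore] -/
theorem succDiff_etaDir (j' : Fin n) (L δ : ℝ) (k : Fin n) :
    succDiff (etaDir d n j' L δ) k = (if k = j' then δ else L) • e₀ d := by
  unfold etaDir
  rw [succDiff_map (fun t : ℝ => t • e₀ d) (fun a b => sub_smul a b _)]
  congr 1
  cases n with
  | zero => exact k.elim0
  | succ m =>
    refine Fin.cases ?_ (fun i => ?_) k
    · rw [succDiff_zero]
      by_cases h : (0 : Fin (m + 1)) = j'
      · subst h; simp
      · have hj0 : ¬ (j' = 0) := fun h0 => h h0.symm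
        simp [h, hj0]
    · rw [succDiff_succ]
      simp only [Fin.val_succ, Fin.val_castSucc]
      by_cases h : i.succ = j'
      · subst h
        simp only [if_true, Fin.val_succ]
        have h1 : ((i : ℕ) + 1 ≤ (i : ℕ) + 1) := le_rfl
        have h2 : ¬ ((i : ℕ) + 1 ≤ (i : ℕ)) := by omega
        simp only [h1, if_true, h2, if_false]
        push_cast; ring
      · simp only [h, if_false]
        have hne : (j' : ℕ) ≠ (i : ℕ) + 1 := fun h' => h (Fin.ext (by simp [h']))
        by_cases hle : (j' : ℕ) ≤ (i : ℕ)
        · have hle' : (j' : ℕ) ≤ (i : ℕ) + 1 := by omega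
          simp only [hle, hle', if_true]; push_cast; ring
        · have hle' : ¬ ((j' : ℕ) ≤ (i : ℕ) + 1) := by omega
          simp only [hle, hle', if_false]; push_cast; ring

/-- `η(L, δ)` lies in the base cone `Γ` of `𝒯ₙ` when `L, δ > 0`. [folklore] -/
theorem etaDir_mem_tubeCone (j' : Fin n) {L δ : ℝ} (hL : 0 < L) (hδ : 0 < δ) :
    etaDir d n j' L δ ∈ tubeCone d n := by
  intro k
  rw [succDiff_etaDir, smul_e₀_mem_forwardCone_iff]
  split_ifs <;> assumption

/-- The components of `η(L, δ)` are bounded by `(|L| + |δ - L|)(n + 1)`... more precisely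
`‖η(L,δ)_k‖ ≤ |L| (n + 1) + |δ − L|`. [folklore] -/
theorem norm_etaDir_le (j' : Fin n) (L δ : ℝ) :
    ‖etaDir d n j' L δ‖ ≤ |L| * ((n : ℝ) + 1) + |δ - L| := by
  refine (pi_norm_le_iff_of_nonneg (by positivity)).2 fun k => ?_
  unfold etaDir
  rw [norm_smul, e₀, PiLp.norm_single, norm_one, mul_one, Real.norm_eq_abs]
  have hk : ((k : ℕ) : ℝ) + 1 ≤ (n : ℝ) + 1 := by
    have := k.isLt; exact_mod_cast (by omega : (k : ℕ) + 1 ≤ n + 1)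
  calc |L * ((k : ℕ) + 1 : ℝ) + (δ - L) * (if (j' : ℕ) ≤ (k : ℕ) then 1 else 0)|
      ≤ |L * ((k : ℕ) + 1 : ℝ)| + |(δ - L) * (if (j' : ℕ) ≤ (k : ℕ) then 1 else 0)| := abs_add_le _ _
    _ ≤ |L| * ((n : ℝ) + 1) + |δ - L| := by
        rw [abs_mul, abs_mul]
        gcongr
        · rw [abs_of_nonneg (by positivity)]; exact hk
        · split_ifs <;> simp

/-- **The permuted direction lies in the base cone**: for `τ = (j j+1)`, `0 < ε < L`, the
configuration `η(L, −ε) ∘ τ` has all successive differences in `V₊` (they are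
`L e₀, …, (L−ε) e₀, ε e₀, (L−ε) e₀, L e₀, …`). [folklore] -/
theorem etaDir_comp_swap_mem_tubeCone (j : Fin n) (hj : (j : ℕ) + 1 < n) {L ε : ℝ} (hL : 0 < L)
    (hε : 0 < ε) (hεL : ε < L) :
    (fun k => etaDir d n ⟨(j : ℕ) + 1, hj⟩ L (-ε) (Equiv.swap j ⟨(j : ℕ) + 1, hj⟩ k)) ∈
      tubeCone d n := by
  set j' : Fin n := ⟨(j : ℕ) + 1, hj⟩ with hj'
  set τ := Equiv.swap j j' with hτ
  -- the scalar sequence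
  set Sc : ℕ → ℝ := fun v => L * ((v : ℝ) + 1) + (-ε - L) * (if (j : ℕ) + 1 ≤ v then 1 else 0)
    with hSc
  have hconf : (fun k => etaDir d n j' L (-ε) (τ k)) = fun k => Sc (τ k : ℕ) • e₀ d := by
    funext k; rfl
  rw [hconf]
  -- values of `Sc`
  have hS_step : ∀ v : ℕ, v ≠ (j : ℕ) → Sc (v + 1) - Sc v = L := by
    intro v hv
    simp only [hSc]
    by_cases h1 : (j : ℕ) + 1 ≤ v
    · have h2 : (j : ℕ) + 1 ≤ v + 1 := by omega
      simp only [h1, h2, if_true]; push_cast; ring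
    · have h2 : ¬ ((j : ℕ) + 1 ≤ v + 1) := by omega
      simp only [h1, h2, if_false]; push_cast; ring
  have hSj : Sc (j : ℕ) = L * ((j : ℕ) + 1 : ℝ) := by
    simp only [hSc]
    have : ¬ ((j : ℕ) + 1 ≤ (j : ℕ)) := by omega
    simp [this]
  have hSj1 : Sc ((j : ℕ) + 1) = L * ((j : ℕ) + 1 : ℝ) + L - ε - L := by
    simp only [hSc, le_refl, if_true]; push_cast; ring
  have hSj2 : Sc ((j : ℕ) + 2) = L * ((j : ℕ) + 1 : ℝ) + 2 * L - ε - L := by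
    simp only [hSc]
    have : (j : ℕ) + 1 ≤ (j : ℕ) + 2 := by omega
    simp only [this, if_true]; push_cast; ring
  have hS0 : Sc 0 = L := by
    simp only [hSc]
    have : ¬ ((j : ℕ) + 1 ≤ 0) := by omega
    simp [this]
  -- values of `τ`
  have hτj : τ j = j' := Equiv.swap_apply_left _ _
  have hτj' : τ j' = j := Equiv.swap_apply_right _ _
  have hτne : ∀ p : Fin n, p ≠ j → p ≠ j' → τ p = p := fun p h1 h2 =>
    Equiv.swap_apply_of_ne_of_ne h1 h2
  intro k
  rw [succDiff_map (fun t : ℝ => t • e₀ d) (fun a b => sub_smul a b _), smul_e₀_mem_forwardCone_iff]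
  cases n with
  | zero => exact k.elim0
  | succ N =>
    refine Fin.cases ?_ (fun m => ?_) k
    · -- k = 0
      rw [succDiff_zero]
      by_cases h0 : (0 : Fin (N + 1)) = j
      · rw [h0, hτj]
        show 0 < Sc ((j : ℕ) + 1)
        rw [hSj1]; nlinarith
      · have h0' : (0 : Fin (N + 1)) ≠ j' := by
          intro h; have := congrArg Fin.val h; simp [hj'] at this
        rw [hτne 0 h0 h0']
        show 0 < Sc 0
        rw [hS0]; exact hL
    · rw [succDiff_succ]
      -- compare `m` with `j`
      by_cases h1 : m.succ = j
      · -- then `m.castSucc = j - 1`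
        have hcs : m.castSucc ≠ j := fun h => by
          have := congrArg Fin.val h; have := congrArg Fin.val h1; simp at *; omega
        have hcs' : m.castSucc ≠ j' := fun h => by
          have := congrArg Fin.val h; have := congrArg Fin.val h1; simp [hj'] at *; omega
        rw [h1, hτj, hτne _ hcs hcs']
        show 0 < Sc (j' : ℕ) - Sc (m.castSucc : ℕ)
        have hm : (m.castSucc : ℕ) + 1 = (j : ℕ) := by
          have := congrArg Fin.val h1; simpa using this
        have hv : Sc (m.castSucc : ℕ) = L * ((j : ℕ) : ℝ) := by
          simp only [hSc]
          have : ¬ ((j : ℕ) + 1 ≤ (m.castSucc : ℕ)) := by omega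
          simp only [this, if_false]
          have : ((m.castSucc : ℕ) : ℝ) + 1 = ((j : ℕ) : ℝ) := by exact_mod_cast hm
          rw [this]; ring
        rw [show ((j' : ℕ)) = (j : ℕ) + 1 from rfl, hSj1, hv]
        nlinarith
      · by_cases h2 : m.castSucc = j
        · have hs : m.succ = j' := by
            apply Fin.ext; have := congrArg Fin.val h2; simp [hj'] at *; omega
          rw [hs, hτj', h2, hτj]
          show 0 < Sc (j : ℕ) - Sc (j' : ℕ)
          rw [show ((j' : ℕ)) = (j : ℕ) + 1 from rfl, hSj1, hSj]
          nlinarith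
        · by_cases h3 : m.castSucc = j'
          · have hs : m.succ ≠ j := h1
            have hs' : m.succ ≠ j' := fun h => by
              have := congrArg Fin.val h; have := congrArg Fin.val h3; simp [hj'] at *; omega
            rw [hτne _ hs hs', h3, hτj']
            show 0 < Sc (m.succ : ℕ) - Sc (j : ℕ)
            have hm : (m.succ : ℕ) = (j : ℕ) + 2 := by
              have := congrArg Fin.val h3; simp [hj'] at this; simp; omega
            rw [hm, hSj2, hSj]
            nlinarith
          · have hs' : m.succ ≠ j' := fun h => by
              apply h2; apply Fin.ext
              have := congrArg Fin.val h; simp [hj'] at *; omega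
            rw [hτne _ h1 hs', hτne _ h2 h3]
            show 0 < Sc (m.succ : ℕ) - Sc (m.castSucc : ℕ)
            have hm : (m.succ : ℕ) = (m.castSucc : ℕ) + 1 := by simp
            have hne : (m.castSucc : ℕ) ≠ (j : ℕ) := fun h => h2 (Fin.ext h)
            rw [hm, hS_step _ hne]
            exact hL

/-! ### Boundary values of the permuted function -/

/-- **The permuted distribution is the boundary value of the permuted function**: if `T` is the
distributional boundary value of `𝔚`, then for a permutation `σ` and a direction `η` with
`η ∘ σ` in the base cone, `∫ 𝔚((x + itη) ∘ σ) F(x) dx → T(F ∘ (· ∘ σ⁻¹))` (permutation of the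
integration variables in the approximating integrals). [folklore] -/
theorem tendsto_perm_of_hasDistributionalBoundaryValue {𝔚 : (Fin n → Fin (d + 1) → ℂ) → ℂ}
    {T : 𝓢((Fin n → SpaceTime d), ℂ) →L[ℂ] ℂ} (hbv : HasDistributionalBoundaryValue 𝔚 T)
    (σ : Equiv.Perm (Fin n)) {η : Fin n → SpaceTime d} (hη : (fun k => η (σ k)) ∈ tubeCone d n)
    (F : 𝓢((Fin n → SpaceTime d), ℂ)) :
    Tendsto (fun t : ℝ => ∫ x : Fin n → SpaceTime d,
        𝔚 (fun k => complexifyPoint (x (σ k)) + ((t : ℂ) * I) • complexifyPoint (η (σ k))) * F x)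
      (𝓝[>] 0) (𝓝 (T (permTest σ⁻¹ F))) := by
  have h := hbv _ hη (permTest σ⁻¹ F)
  refine h.congr fun t => ?_
  rw [← integral_comp_perm_spaceTime σ (fun x : Fin n → SpaceTime d =>
    𝔚 (fun k => complexifyPoint (x k) + ((t : ℂ) * I) • complexifyPoint (η (σ k))) *
      permTest σ⁻¹ F x)]
  refine integral_congr_ae (Eventually.of_forall fun x => ?_)
  simp only [permTest_apply]
  congr 2
  funext k
  simp

/-! ### Complexified configurations as a continuous linear map -/

variable (d n) in
/-- `x ↦ (x_k)_k ∈ (ℂ^{1+d})^n`, the componentwise complexification of a real configuration, as a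
continuous real-linear map (the `J` of `BoundaryValueLimit`). [folklore] -/
def cpxConfigCLM : (Fin n → SpaceTime d) →L[ℝ] (Fin n → Fin (d + 1) → ℂ) :=
  ContinuousLinearMap.pi fun k => ContinuousLinearMap.pi fun μ =>
    Complex.ofRealCLM.comp ((EuclideanSpace.proj μ).comp (ContinuousLinearMap.proj k))

/-- `cpxConfigCLM x = (complexifyPoint x_k)_k`. [folklore] -/
@[simp] theorem cpxConfigCLM_apply (x : Fin n → SpaceTime d) :
    cpxConfigCLM d n x = fun k => complexifyPoint (x k) := rfl

/-! ### Polynomial growth at the edge of the tube -/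

/-- **Polynomial growth of `𝔚` at the edge of the forward tube**, locally uniformly: for every
compact set `K` of directions in the base cone and every radius `R` there are `C, r` with
`‖𝔚(x + itη)‖ ≤ C t^{-r}` for `‖x‖ ≤ R`, `η ∈ K`, `0 < t < 1` (the estimate delivered by the
Fourier–Laplace representation, Streater–Wightman (1964) Thm. 2-10, eq. (2-80); Vladimirov (1966)
§26.4). [cite: StreaterWightman1964, Thm 2-10 eq. (2-80)] -/
def HasEdgeGrowth (𝔚 : (Fin n → Fin (d + 1) → ℂ) → ℂ) : Prop :=
  ∀ K : Set (Fin n → SpaceTime d), IsCompact K → K ⊆ tubeCone d n → ∀ R : ℝ,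
    ∃ (C : ℝ) (r : ℕ), ∀ x : Fin n → SpaceTime d, ‖x‖ ≤ R → ∀ η ∈ K, ∀ t : ℝ, 0 < t → t < 1 →
      ‖𝔚 (fun k => complexifyPoint (x k) + ((t : ℂ) * I) • complexifyPoint (η k))‖ ≤ C * t⁻¹ ^ r

/-! ### The complex boost as an element of `L₊(ℂ)` -/

/-- The coordinate complex boost `B_i(w)` is the plane boost in the Lorentzian 2-frame
`(e₀, e_{i})`. [folklore] -/
theorem boostC_eq_planeBoost (i : Fin d) (w : ℂ) (v : Fin (d + 1) → ℂ) :
    boostC i w v = planeBoost (e₀ d) (EuclideanSpace.single i.succ (1 : ℝ)) w v := by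
  rw [planeBoost_apply]
  have he : complexMinkowskiForm d (complexifyPoint (e₀ d)) v = v 0 := by
    rw [complexMinkowskiForm_apply]
    simp [Fin.succ_ne_zero]
  have hs : complexMinkowskiForm d (complexifyPoint (EuclideanSpace.single i.succ (1 : ℝ))) v =
      -v i.succ := by
    rw [complexMinkowskiForm_apply]
    simp only [complexifyPoint_apply, PiLp.single_apply, (Fin.succ_ne_zero i).symm, if_false,
      Complex.ofReal_zero, zero_mul, zero_sub, Fin.succ_inj]
    rw [Finset.sum_eq_single i (fun b _ hb => by simp [hb]) (fun h => absurd (Finset.mem_univ i) h)]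
    simp
  rw [he, hs]
  ext μ
  simp only [boostC, Pi.add_apply, Pi.smul_apply, complexifyPoint_apply, e₀_apply,
    PiLp.single_apply, smul_eq_mul]
  by_cases hμ : μ = 0
  · subst hμ
    simp [(Fin.succ_ne_zero i).symm]
    ring
  · simp only [hμ, if_false]
    by_cases hμi : μ = i.succ
    · subst hμi; simp; ring
    · simp [hμi]

/-- `η(e₀, e₀) = 1`, `η(eᵢ, eᵢ) = −1`, `η(e₀, eᵢ) = 0` for a spatial coordinate vector. [folklore] -/
theorem frame_e₀_single (i : Fin d) :
    minkowskiForm d (e₀ d) (e₀ d) = 1 ∧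
      minkowskiForm d (EuclideanSpace.single i.succ (1 : ℝ)) (EuclideanSpace.single i.succ (1 : ℝ)) = -1 ∧
      minkowskiForm d (e₀ d) (EuclideanSpace.single i.succ (1 : ℝ)) = 0 := by
  refine ⟨minkowskiForm_e₀_e₀, ?_, ?_⟩
  · rw [minkowskiForm_apply]
    simp only [PiLp.single_apply, (Fin.succ_ne_zero i).symm, if_false, mul_zero, zero_sub,
      Fin.succ_inj]
    rw [Finset.sum_eq_single i (fun b _ hb => by simp [hb]) (fun h => absurd (Finset.mem_univ i) h)]
    simp
  · rw [minkowskiForm_e₀_left]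
    simp [(Fin.succ_ne_zero i).symm]


/-! ### The local commutativity theorem -/

/-- `succDiff` at the index `j + 1`. [folklore] -/
theorem succDiff_mk_succ {α : Type*} [AddGroup α] (x : Fin n → α) (j : Fin n)
    (hj : (j : ℕ) + 1 < n) :
    succDiff x ⟨(j : ℕ) + 1, hj⟩ = x ⟨(j : ℕ) + 1, hj⟩ - x j := by
  cases n with
  | zero => exact j.elim0
  | succ N =>
    have h : (⟨(j : ℕ) + 1, hj⟩ : Fin (N + 1)) = Fin.succ ⟨j, by omega⟩ := rfl
    rw [h, succDiff_succ]
    rfl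

/-- A closed set of directions with margins bounded below and norms bounded above is a compact
subset of the base cone. [folklore] -/
theorem isCompact_dirSet (κ C : ℝ) :
    IsCompact {η : Fin n → SpaceTime d | (∀ k, κ ≤ coneMargin (succDiff η k)) ∧ ‖η‖ ≤ C} := by
  have h1 : IsClosed {η : Fin n → SpaceTime d | ∀ k, κ ≤ coneMargin (succDiff η k)} := by
    rw [Set.setOf_forall]
    exact isClosed_iInter fun k =>
      isClosed_le continuous_const (continuous_coneMargin.comp (continuous_succDiff k))
  have h2 : IsClosed {η : Fin n → SpaceTime d | ‖η‖ ≤ C} :=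
    isClosed_le continuous_norm continuous_const
  refine Metric.isCompact_of_isClosed_isBounded (h1.inter h2) ?_
  exact (Metric.isBounded_closedBall (x := (0 : Fin n → SpaceTime d)) (r := C)).subset
    fun _ hη => mem_closedBall_zero_iff.2 hη.2

/-- Such a set of directions lies in the base cone when `κ > 0`. [folklore] -/
theorem dirSet_subset_tubeCone {κ : ℝ} (hκ : 0 < κ) (C : ℝ) :
    {η : Fin n → SpaceTime d | (∀ k, κ ≤ coneMargin (succDiff η k)) ∧ ‖η‖ ≤ C} ⊆ tubeCone d n :=
  fun _ hη k => (mem_forwardCone_iff_coneMargin_pos _).2 (hκ.trans_le (hη.1 k))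

/-- **The boosted point in ray form.** For `0 ≤ c ≤ 1`, `‖x‖ ≤ Rₓ`, `0 < ‖y‖ ≤ 1` and margins
`κ₃‖y‖` of the boosted successive differences, the boosted point `B_i(i c‖y‖)(x + iy)` is
`x' + i‖y‖ η'` with `‖x'‖ ≤ 3Rₓ + 2`, all margins of `η'` at least `κ₃` and `‖η'‖ ≤ 3 + 2Rₓ`.
[folklore] -/
theorem boost_point_ray (i : Fin d) {c : ℝ} (hc0 : 0 ≤ c) (hc1 : c ≤ 1)
    {x y : Fin n → SpaceTime d} {Rx : ℝ} (hx : ‖x‖ ≤ Rx) (hy0 : 0 < ‖y‖) (hy1 : ‖y‖ ≤ 1) {κ₃ : ℝ}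
    (hmarg : ∀ k, κ₃ * ‖y‖ ≤ coneMargin (imPart (succDiff (boostConfig n i (((c * ‖y‖ : ℝ) : ℂ) * I)
      (fun k => complexifyPoint (x k) + (I : ℂ) • complexifyPoint (y k))) k))) :
    ∃ x' η' : Fin n → SpaceTime d, ‖x'‖ ≤ 3 * Rx + 2 ∧ (∀ k, κ₃ ≤ coneMargin (succDiff η' k)) ∧
      ‖η'‖ ≤ 3 + 2 * Rx ∧
      boostConfig n i (((c * ‖y‖ : ℝ) : ℂ) * I)
          (fun k => complexifyPoint (x k) + (I : ℂ) • complexifyPoint (y k)) =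
        fun k => complexifyPoint (x' k) + ((‖y‖ : ℂ) * I) • complexifyPoint (η' k) := by
  have hRx : 0 ≤ Rx := (norm_nonneg _).trans hx
  have hα0 : 0 ≤ c * ‖y‖ := mul_nonneg hc0 hy0.le
  have hα1 : c * ‖y‖ ≤ 1 := mul_le_one₀ hc1 hy0.le hy1
  obtain ⟨B, hB⟩ : ∃ B : Fin n → Fin (d + 1) → ℂ, B = boostConfig n i (((c * ‖y‖ : ℝ) : ℂ) * I)
      (fun k => complexifyPoint (x k) + (I : ℂ) • complexifyPoint (y k)) := ⟨_, rfl⟩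
  rw [← hB] at hmarg ⊢
  refine ⟨fun k => rePart (B k), ‖y‖⁻¹ • fun k => imPart (B k), ?_, fun k => ?_, ?_, ?_⟩
  · refine (pi_norm_le_iff_of_nonneg (by positivity)).2 fun k => ?_
    show ‖rePart (B k)‖ ≤ 3 * Rx + 2
    rw [hB, boostConfig_apply]
    have h := norm_rePart_boostC_le i hα0 hα1 (x k) (y k)
    have h1 : ‖x k‖ ≤ Rx := (norm_le_pi_norm x k).trans hx
    have h2 : ‖y k‖ ≤ 1 := (norm_le_pi_norm y k).trans hy1
    linarith
  · have h := hmarg k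
    have hsd : succDiff (fun k => imPart (B k)) k = imPart (succDiff B k) :=
      succDiff_map imPart imPart_sub B k
    rw [succDiff_smul, coneMargin_smul (inv_nonneg.2 hy0.le), hsd, le_inv_mul_iff₀ hy0, mul_comm]
    exact h
  · have hsm : ‖‖y‖⁻¹ • fun k => imPart (B k)‖ = ‖y‖⁻¹ * ‖fun k => imPart (B k)‖ := by
      rw [norm_smul, norm_inv, norm_norm]
    rw [hsm, inv_mul_le_iff₀ hy0]
    have hC0 : 0 ≤ ‖y‖ * (3 + 2 * Rx) := by positivity
    refine (pi_norm_le_iff_of_nonneg hC0).2 fun k => ?_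
    show ‖imPart (B k)‖ ≤ ‖y‖ * (3 + 2 * Rx)
    rw [hB, boostConfig_apply]
    have h := norm_imPart_boostC_le i hα0 hα1 (x k) (y k)
    have h1 : ‖x k‖ ≤ Rx := (norm_le_pi_norm x k).trans hx
    have h2 : ‖y k‖ ≤ ‖y‖ := norm_le_pi_norm y k
    calc _ ≤ 3 * ‖y k‖ + 2 * (c * ‖y‖) * ‖x k‖ := h
      _ ≤ 3 * ‖y‖ + 2 * (1 * ‖y‖) * Rx := by gcongr
      _ = ‖y‖ * (3 + 2 * Rx) := by ring
  · funext k
    have h1 : (‖y‖⁻¹ • fun k => imPart (B k)) k = ‖y‖⁻¹ • imPart (B k) := rfl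
    rw [h1, ray_eq_add_I_smul, smul_smul, mul_inv_cancel₀ hy0.ne', one_smul]
    exact (complexifyPoint_rePart_add_imPart (B k)).symm

/-- **The BHW continuation at a point whose boost lies in the tube**: if `W` extends `𝔚` to the
extended tube `L₊(ℂ)`-invariantly and `B_i(w) z ∈ 𝒯ₙ`, then `z ∈ 𝒯'ₙ` and `W z = 𝔚(B_i(w) z)`
(`B_i(w) ∈ L₊(ℂ)`, `boostC_eq_planeBoost`, `planeBoostEquiv_mem_properComplexLorentzGroup`).
[folklore] -/
theorem bhw_apply_eq_of_boost_mem {W 𝔚 : (Fin n → Fin (d + 1) → ℂ) → ℂ}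
    (hWeq : Set.EqOn W 𝔚 (forwardTube d n))
    (hWinv : ∀ Λ ∈ properComplexLorentzGroup d, ∀ z ∈ extendedForwardTube d n,
      W (fun k => Λ (z k)) = W z)
    (i : Fin d) (w : ℂ) {z : Fin n → Fin (d + 1) → ℂ} (hBz : boostConfig n i w z ∈ forwardTube d n) :
    z ∈ extendedForwardTube d n ∧ W z = 𝔚 (boostConfig n i w z) := by
  obtain ⟨he, hs, hes⟩ := frame_e₀_single (d := d) i
  set Λ := planeBoostEquiv he hs hes w with hΛ
  have hΛmem : Λ ∈ properComplexLorentzGroup d :=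
    planeBoostEquiv_mem_properComplexLorentzGroup he hs hes _
  have hΛz : (fun k => Λ (z k)) = boostConfig n i w z := by
    funext k
    rw [hΛ, planeBoostEquiv_apply, boostConfig_apply, boostC_eq_planeBoost]
  have hz' : z ∈ extendedForwardTube d n := by
    have h1 : (fun k => Λ (z k)) ∈ extendedForwardTube d n :=
      hΛz ▸ forwardTube_subset_extendedForwardTube hBz
    have h2 := mem_extendedForwardTube_of_mem h1 (Subgroup.inv_mem _ hΛmem)
    have h3 : (fun k => Λ⁻¹ ((fun k => Λ (z k)) k)) = z := by
      funext k
      exact LinearEquiv.symm_apply_apply Λ (z k)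
    rwa [h3] at h2
  refine ⟨hz', ?_⟩
  rw [← hWeq hBz, ← hΛz]
  exact (hWinv Λ hΛmem z hz').symm

section Geometry

/-- **The directions `η(L, δ)` lie in the local cone** when `κ₁ (n + 3) < 1`, `|δ| < κ₂ L` and
`|δ − L| ≤ 2L`. [folklore] -/
theorem etaDir_mem_localCone {j j' : Fin n} (hjj' : j ≠ j') {κ₁ κ₂ L δ : ℝ} (hL : 0 < L)
    (hκ₁ : 0 < κ₁) (hκ₁n : κ₁ * ((n : ℝ) + 3) < 1) (hδ : |δ| < κ₂ * L)
    (hδL : |δ - L| ≤ 2 * L) : etaDir d n j' L δ ∈ localCone n j' j κ₁ κ₂ := by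
  have h := norm_etaDir_le (d := d) (n := n) j' L δ
  rw [abs_of_pos hL] at h
  have hn : κ₁ * ‖etaDir d n j' L δ‖ < L := by
    have h1 : ‖etaDir d n j' L δ‖ ≤ L * ((n : ℝ) + 3) := by linarith
    calc κ₁ * ‖etaDir d n j' L δ‖ ≤ κ₁ * (L * ((n : ℝ) + 3)) := by gcongr
      _ = (κ₁ * ((n : ℝ) + 3)) * L := by ring
      _ < 1 * L := by gcongr
      _ = L := one_mul L
  refine ⟨fun k hk => ?_, ?_⟩
  · rw [succDiff_etaDir, if_neg hk, coneMargin_smul_e₀]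
    exact hn
  · rw [succDiff_etaDir, succDiff_etaDir, if_pos rfl, if_neg hjj', coneMargin_smul_e₀, norm_smul,
      e₀, PiLp.norm_single, norm_one, mul_one, Real.norm_eq_abs]
    exact hδ

/-- **Margins of the boosted successive differences on the local tube.** With the constants
constrained as in the proof of `apply_permTest_swap_eq_of_edgeGrowth` (`8ρ ≤ μ₀`,
`‖x₀‖ + ρ ≤ Rₓ`, `A = 2Rₓ`, `2cA ≤ κ₁/4`, `2γ ≤ κ₁/4`, `γ ≤ 1`, `κ₂ = cμ₀/48`,
`κ₃ ≤ min(κ₁/2, cμ₀/8)`), for `x ∈ B(x₀, ρ)`, `y` in the local cone and `‖y‖ < γ`, every successive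
difference of `B_i(i c‖y‖)(x + iy)` has imaginary part in `V₊` with margin `≥ κ₃ ‖y‖`. [folklore] -/
theorem boost_margin_of_mem_localCone (i : Fin d) (j : Fin n) (hj : (j : ℕ) + 1 < n)
    {x₀ : Fin n → SpaceTime d} {μ₀ ρ Rx κ₁ κ₂ c γ κ₃ : ℝ}
    (hμ₀ : μ₀ = (x₀ ⟨(j : ℕ) + 1, hj⟩ - x₀ j) i.succ - |(x₀ ⟨(j : ℕ) + 1, hj⟩ - x₀ j) 0|)
    (hμ₀pos : 0 < μ₀) (hρ : 8 * ρ ≤ μ₀) (hRx : ‖x₀‖ + ρ ≤ Rx) (hc0 : 0 ≤ c) (hc1 : c ≤ 1)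
    (hcA : 2 * c * (2 * Rx) ≤ κ₁ / 4) (hγ1 : γ ≤ 1) (hγκ : 2 * γ ≤ κ₁ / 4) (hκ₂ : κ₂ = c * μ₀ / 48)
    (hκ₂0 : 0 ≤ κ₂) (hκ₃1 : κ₃ ≤ κ₁ / 2) (hκ₃2 : κ₃ ≤ c * μ₀ / 8)
    {x : Fin n → SpaceTime d} (hx : x ∈ ball x₀ ρ) {y : Fin n → SpaceTime d}
    (hy : y ∈ localCone n ⟨(j : ℕ) + 1, hj⟩ j κ₁ κ₂) (hyγ : ‖y‖ < γ) (k : Fin n) :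
    κ₃ * ‖y‖ ≤ coneMargin (imPart (succDiff (boostConfig n i (((c * ‖y‖ : ℝ) : ℂ) * I)
      (fun k => complexifyPoint (x k) + (I : ℂ) • complexifyPoint (y k))) k)) := by
  set j' : Fin n := ⟨(j : ℕ) + 1, hj⟩ with hj'def
  -- geometry of `x ∈ B(x₀, ρ)`
  rw [mem_ball, dist_eq_norm] at hx
  have hnx : ‖x‖ ≤ Rx := by
    have := norm_le_norm_add_norm_sub' x x₀
    linarith
  have hξ : μ₀ / 2 ≤ (succDiff x j') i.succ - |(succDiff x j') 0| := by
    rw [succDiff_mk_succ]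
    set ξ : SpaceTime d := x j' - x j with hξ
    set ξ₀ : SpaceTime d := x₀ j' - x₀ j with hξ₀
    have hdiff : ‖ξ - ξ₀‖ < 2 * ρ := by
      have h1 : ‖x j' - x₀ j'‖ ≤ ‖x - x₀‖ := norm_le_pi_norm (x - x₀) j'
      have h2 : ‖x j - x₀ j‖ ≤ ‖x - x₀‖ := norm_le_pi_norm (x - x₀) j
      calc ‖ξ - ξ₀‖ = ‖(x j' - x₀ j') - (x j - x₀ j)‖ := by rw [hξ, hξ₀]; abel_nf
        _ ≤ ‖x j' - x₀ j'‖ + ‖x j - x₀ j‖ := norm_sub_le _ _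
        _ < 2 * ρ := by linarith
    have hc1' : |(ξ - ξ₀) i.succ| ≤ ‖ξ - ξ₀‖ := abs_apply_le_norm _ _
    have hc0' : |(ξ - ξ₀) 0| ≤ ‖ξ - ξ₀‖ := abs_apply_le_norm _ _
    simp only [PiLp.sub_apply] at hc1' hc0'
    have h3 : |ξ 0| ≤ |ξ₀ 0| + |ξ 0 - ξ₀ 0| := by
      have := abs_add_le (ξ₀ 0) (ξ 0 - ξ₀ 0); rwa [add_sub_cancel] at this
    have h4 := neg_abs_le (ξ i.succ - ξ₀ i.succ)
    have h5 := le_abs_self (ξ i.succ - ξ₀ i.succ)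
    have hμ₀' : μ₀ = ξ₀ i.succ - |ξ₀ 0| := hμ₀
    linarith
  -- the margin estimate
  rw [succDiff_boostConfig, succDiff_add_I_smul]
  have hν0 : 0 ≤ ‖y‖ := norm_nonneg _
  have hb2 : ‖succDiff y k‖ ≤ 2 * ‖y‖ := norm_succDiff_le y k
  by_cases hk : k = j'
  · subst hk
    have hb : ‖succDiff y j'‖ ≤ 2 * (c * μ₀ / 48) * ‖y‖ := by
      rw [← hκ₂]; exact norm_succDiff_lt_of_mem_localCone hκ₂0 hy
    have hα1 : c * ‖y‖ ≤ 1 := mul_le_one₀ hc1 hν0 (hyγ.le.trans hγ1)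
    have h := margin_near i hc0 hμ₀pos.le hν0 hα1 hξ hb
    have h' : κ₃ * ‖y‖ ≤ (c * μ₀ / 8) * ‖y‖ := mul_le_mul_of_nonneg_right hκ₃2 hν0
    linarith
  · have hm : κ₁ * ‖y‖ ≤ coneMargin (succDiff y k) := (hy.1 k hk).le
    have hA0 : 0 ≤ 2 * Rx := by linarith [norm_nonneg x₀, norm_nonneg x, hnx]
    have ha : ‖succDiff x k‖ ≤ 2 * Rx := (norm_succDiff_le x k).trans (by linarith)
    have h := margin_far i hc0 hc1 hA0 hcA hγ1 hγκ hν0 hyγ.le ha hb2 hm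
    have h' : κ₃ * ‖y‖ ≤ (κ₁ / 2) * ‖y‖ := mul_le_mul_of_nonneg_right hκ₃1 hν0
    linarith

end Geometry

section Main

variable [NeZero d] {S : SchwingerFamily (EuclideanSpace ℝ (Fin (d + 1)))}
  {𝔚 : (Fin n → Fin (d + 1) → ℂ) → ℂ} {T : 𝓢((Fin n → SpaceTime d), ℂ) →L[ℂ] ℂ}

/-- **The analytic step of the local commutativity theorem.** Given: the OS continuation `𝔚`
(E1, E3, holomorphic on `𝒯ₙ`, Euclidean restriction `𝔖ₙ`, boundary value `T`, edge growth), the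
BHW theorem, an imaginary boost direction `i`, an involutive permutation `τ`, a set `O` of real
configurations and an open convex cone `Γ'` of directions (`0 ∉ Γ'`) such that for `x ∈ O`,
`y ∈ Γ'`, `‖y‖ < γ ≤ 1/2` the boosted point `B_i(ic‖y‖)(x + iy)` lies in `𝒯ₙ` and has the ray form
`x' + i‖y‖η'` with `‖x'‖ ≤ R'`, margins `≥ κ₃ > 0` and `‖η'‖ ≤ C₄`; a direction `η₊ ∈ Γ ∩ Γ'`; and a
direction `η₋ ∈ Γ'` with `η₋ ∘ τ ∈ Γ`. Then `T F = T (F ∘ (· ∘ τ))` for every `F` compactly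
supported in `O` (BHW continuation `W`; `W = 𝔚 ∘ B` and polynomial growth on the local tube;
Hörmander's Thm. 3.1.15; identification of the two ray limits through
`apply_perm_eq_apply_boostC`). [cite: OsterwalderSchraderCMP1973, §4.5] -/
theorem apply_permTest_eq_of_localTube (hE1 : S.IsEuclideanCovariant) (hE3 : S.IsSymmetric)
    (h𝔚 : DifferentiableOn ℂ 𝔚 (forwardTube d n)) (hbv : HasDistributionalBoundaryValue 𝔚 T)
    (hS : ∀ F : 𝓢((Fin n → EuclideanSpace ℝ (Fin (d + 1))), ℂ), IsTimeOrdered F →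
      S n F = ∫ x, 𝔚 (euclideanPoint x) * F x)
    (hgrowth : HasEdgeGrowth 𝔚) (hBHW : exists_extension_extendedForwardTube (d := d) (n := n))
    (i : Fin d) {τ : Equiv.Perm (Fin n)} (hτinv : τ⁻¹ = τ)
    {O Γ' : Set (Fin n → SpaceTime d)} (hΓ'o : IsOpen Γ') (hΓ'c : Convex ℝ Γ')
    (hΓ'cone : ∀ s : ℝ, 0 < s → ∀ y ∈ Γ', s • y ∈ Γ') (hΓ'0 : (0 : Fin n → SpaceTime d) ∉ Γ')
    {c γ κ₃ R' C₄ : ℝ} (hγpos : 0 < γ) (hγhalf : γ ≤ 1 / 2) (hκ₃pos : 0 < κ₃)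
    (key_mem : ∀ x ∈ O, ∀ y ∈ Γ', ‖y‖ < γ →
      boostConfig n i (((c * ‖y‖ : ℝ) : ℂ) * I)
        (fun k => complexifyPoint (x k) + (I : ℂ) • complexifyPoint (y k)) ∈ forwardTube d n)
    (key_ray : ∀ x ∈ O, ∀ y ∈ Γ', ‖y‖ < γ →
      ∃ (x' η' : Fin n → SpaceTime d), ‖x'‖ ≤ R' ∧ (∀ k, κ₃ ≤ coneMargin (succDiff η' k)) ∧
        ‖η'‖ ≤ C₄ ∧
        boostConfig n i (((c * ‖y‖ : ℝ) : ℂ) * I)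
          (fun k => complexifyPoint (x k) + (I : ℂ) • complexifyPoint (y k)) =
          fun k => complexifyPoint (x' k) + ((‖y‖ : ℂ) * I) • complexifyPoint (η' k))
    {ηp ηm : Fin n → SpaceTime d} (hηpΓ : ηp ∈ tubeCone d n) (hηpΓ' : ηp ∈ Γ') (hηmΓ' : ηm ∈ Γ')
    (hηmτΓ : (fun k => ηm (τ k)) ∈ tubeCone d n)
    (F : 𝓢((Fin n → SpaceTime d), ℂ)) (hFc : HasCompactSupport (F : (Fin n → SpaceTime d) → ℂ))
    (hFO : tsupport (F : (Fin n → SpaceTime d) → ℂ) ⊆ O) :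
    T F = T (permTest τ F) := by
  -- the compact set of directions and the growth constants
  obtain ⟨K, hK⟩ : ∃ K : Set (Fin n → SpaceTime d),
      K = {η | (∀ k, κ₃ ≤ coneMargin (succDiff η k)) ∧ ‖η‖ ≤ C₄} := ⟨_, rfl⟩
  have hKc : IsCompact K := hK ▸ isCompact_dirSet κ₃ C₄
  have hKΓ : K ⊆ tubeCone d n := hK ▸ dirSet_subset_tubeCone hκ₃pos C₄
  obtain ⟨C, r, hC⟩ := hgrowth K hKc hKΓ R'
  -- the Bargmann–Hall–Wightman continuation
  have hinv : ∀ Λ : restrictedLorentzGroup d, ∀ z ∈ forwardTube d n,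
      𝔚 (fun k => lorentzActC (Λ : SpaceTime d ≃L[ℝ] SpaceTime d) (z k)) = 𝔚 z := by
    intro Λ z hz
    have hm := (mem_restrictedLorentzGroup_iff (Λ : SpaceTime d ≃L[ℝ] SpaceTime d)).1 Λ.2
    exact tubeInvariant_of_orthochronous hE1 h𝔚 hS hm.1 hm.2.1 z hz
  obtain ⟨W, hWd, hWeq, hWinv⟩ := hBHW 𝔚 h𝔚 hinv
  have hW : ∀ x ∈ O, ∀ y ∈ Γ', ‖y‖ < γ →
      (fun k => complexifyPoint (x k) + (I : ℂ) • complexifyPoint (y k)) ∈ extendedForwardTube d n ∧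
      W (fun k => complexifyPoint (x k) + (I : ℂ) • complexifyPoint (y k)) =
        𝔚 (boostConfig n i (((c * ‖y‖ : ℝ) : ℂ) * I)
          (fun k => complexifyPoint (x k) + (I : ℂ) • complexifyPoint (y k))) :=
    fun x hx y hy hyγ => bhw_apply_eq_of_boost_mem hWeq hWinv i _ (key_mem x hx y hy hyγ)
  -- growth of `W` on the local tube
  have hform : ∀ x y : Fin n → SpaceTime d, cpxConfigCLM d n x + (I : ℂ) • cpxConfigCLM d n y =
      fun k => complexifyPoint (x k) + (I : ℂ) • complexifyPoint (y k) := fun x y => by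
    funext k; rfl
  have hWbound : ∀ x ∈ O, ∀ y ∈ Γ', ‖y‖ < γ →
      ‖W (cpxConfigCLM d n x + (I : ℂ) • cpxConfigCLM d n y)‖ ≤ |C| * ‖y‖⁻¹ ^ r := by
    intro x hx y hy hyγ
    have hy0 : 0 < ‖y‖ := norm_pos_iff.2 fun h => hΓ'0 (h ▸ hy)
    rw [hform, (hW x hx y hy hyγ).2]
    obtain ⟨x', η', hx', hη'1, hη'2, hEq⟩ := key_ray x hx y hy hyγ
    rw [hEq]
    have hy1 : ‖y‖ < 1 := hyγ.trans_le (hγhalf.trans (by norm_num))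
    have hη' : η' ∈ K := by rw [hK]; exact ⟨hη'1, hη'2⟩
    exact (hC x' hx' η' hη' ‖y‖ hy0 hy1).trans
      (mul_le_mul_of_nonneg_right (le_abs_self C) (by positivity))
  have htube : ∀ x ∈ O, ∀ y ∈ Γ', ‖y‖ < γ →
      cpxConfigCLM d n x + (I : ℂ) • cpxConfigCLM d n y ∈ extendedForwardTube d n := by
    intro x hx y hy hyγ
    rw [hform]; exact (hW x hx y hy hyγ).1
  -- Hörmander's theorem: the boundary value of `W` from `Γ'`
  obtain ⟨ℓ, hℓ⟩ := tendsto_integral_of_norm_le_inv_pow (μ := volume) (J := cpxConfigCLM d n)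
    isOpen_extendedForwardTube hWd hΓ'o hΓ'c hΓ'cone hΓ'0 hγpos htube hWbound
    (F.smooth ⊤) hFc hFO
  -- rays in `Γ'`
  have hray : ∀ η ∈ Γ', Tendsto (fun t : ℝ => t • η) (𝓝[>] 0) (𝓝[Γ'] 0) := by
    intro η hη
    refine tendsto_nhdsWithin_iff.2 ⟨?_, ?_⟩
    · have hc : Continuous fun t : ℝ => t • η := continuous_id.smul continuous_const
      have h0 : Tendsto (fun t : ℝ => t • η) (𝓝 0) (𝓝 ((0 : ℝ) • η)) := hc.tendsto 0
      rw [zero_smul] at h0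
      exact h0.mono_left nhdsWithin_le_nhds
    · exact eventually_nhdsWithin_of_forall fun t ht => hΓ'cone t ht η hη
  -- along `η₊`: the limit is `T F`
  have h1 : ℓ = T F := by
    have hA := hℓ.comp (hray ηp hηpΓ')
    have hB := hbv ηp hηpΓ F
    refine tendsto_nhds_unique hA (hB.congr' ?_)
    refine eventually_nhdsWithin_of_forall fun t (ht : 0 < t) => ?_
    simp only [Function.comp_apply]
    refine integral_congr_ae (Eventually.of_forall fun x => ?_)
    beta_reduce
    have hform' : cpxConfigCLM d n x + (I : ℂ) • cpxConfigCLM d n (t • ηp) =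
        fun k => complexifyPoint (x k) + ((t : ℂ) * I) • complexifyPoint (ηp k) := by
      funext k; rw [ray_eq_add_I_smul]; rfl
    rw [hform', hWeq (mem_forwardTube_of_mem_tubeCone x ηp hηpΓ ht), mul_comm]
  -- along `η₋`: the limit is `T (F ∘ τ)`
  have h2 : ℓ = T (permTest τ F) := by
    have hA := hℓ.comp (hray ηm hηmΓ')
    have hB := tendsto_perm_of_hasDistributionalBoundaryValue hbv τ hηmτΓ F
    rw [hτinv] at hB
    refine tendsto_nhds_unique hA (hB.congr' ?_)
    have hev : ∀ᶠ t : ℝ in 𝓝[>] 0, 0 < t ∧ t * ‖ηm‖ < γ := by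
      refine (eventually_nhdsWithin_of_forall fun t ht => ht).and ?_
      have : Tendsto (fun t : ℝ => t * ‖ηm‖) (𝓝[>] 0) (𝓝 0) := by
        have hc : Continuous fun t : ℝ => t * ‖ηm‖ := continuous_id.mul continuous_const
        have h := hc.tendsto 0
        rw [zero_mul] at h
        exact h.mono_left nhdsWithin_le_nhds
      exact this.eventually (gt_mem_nhds hγpos)
    filter_upwards [hev] with t ⟨ht, htγ⟩
    simp only [Function.comp_apply]
    refine integral_congr_ae (Eventually.of_forall fun x => ?_)
    beta_reduce
    by_cases hxF : x ∈ tsupport (F : (Fin n → SpaceTime d) → ℂ)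
    · have hx : x ∈ O := hFO hxF
      have hy : t • ηm ∈ Γ' := hΓ'cone t ht ηm hηmΓ'
      have hyγ : ‖t • ηm‖ < γ := by
        rwa [norm_smul, Real.norm_eq_abs, abs_of_pos ht]
      rw [hform, (hW x hx _ hy hyγ).2]
      -- the functional equation `𝔚(B z) = 𝔚(z ∘ τ)`
      have hzB := key_mem x hx _ hy hyγ
      have hzτ : (fun k => (fun k' => complexifyPoint (x k') + (I : ℂ) • complexifyPoint ((t • ηm) k'))
          (τ k)) = fun k => complexifyPoint (x (τ k)) + ((t : ℂ) * I) • complexifyPoint (ηm (τ k)) := by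
        funext k; rw [ray_eq_add_I_smul]; rfl
      have hzτmem : (fun k => (fun k' => complexifyPoint (x k') + (I : ℂ) •
          complexifyPoint ((t • ηm) k')) (τ k)) ∈ forwardTube d n := by
        rw [hzτ]
        exact mem_forwardTube_of_mem_tubeCone (fun k => x (τ k)) (fun k => ηm (τ k)) hηmτΓ ht
      rw [← apply_perm_eq_apply_boostC hE1 hE3 h𝔚 hS τ i (c * ‖t • ηm‖) hzτmem hzB, hzτ,
        mul_comm]
    · have h0 : F x = 0 := image_eq_zero_of_notMem_tsupport hxF
      simp [h0]
  rw [← h1, ← h2]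

/-- **Local commutativity of the OS boundary values near a space-like pair** (the core of
Osterwalder–Schrader I, §4.5, in the local-tube form described in the module docstring). Let
`𝔚` be the OS continuation of `𝔖ₙ` (E1, E3, holomorphic on `𝒯ₙ`, Euclidean restriction `𝔖ₙ`)
with distributional boundary value `T` and polynomial growth at the edge of the tube, and assume
the Bargmann–Hall–Wightman theorem for `𝒯ₙ`. If `ξ₀ = x₀_{j+1} − x₀_j` satisfies `|ξ₀⁰| < ξ₀¹`,
then `T F = T (F ∘ (j j+1))` for all test functions `F` compactly supported in a neighbourhood of
`x₀`. [cite: OsterwalderSchraderCMP1973, §4.5] -/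
theorem apply_permTest_swap_eq_of_edgeGrowth (hE1 : S.IsEuclideanCovariant) (hE3 : S.IsSymmetric)
    (h𝔚 : DifferentiableOn ℂ 𝔚 (forwardTube d n)) (hbv : HasDistributionalBoundaryValue 𝔚 T)
    (hS : ∀ F : 𝓢((Fin n → EuclideanSpace ℝ (Fin (d + 1))), ℂ), IsTimeOrdered F →
      S n F = ∫ x, 𝔚 (euclideanPoint x) * F x)
    (hgrowth : HasEdgeGrowth 𝔚) (hBHW : exists_extension_extendedForwardTube (d := d) (n := n))
    (j : Fin n) (hj : (j : ℕ) + 1 < n) {x₀ : Fin n → SpaceTime d}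
    (hx₀ : |(x₀ ⟨(j : ℕ) + 1, hj⟩ - x₀ j) 0| <
      (x₀ ⟨(j : ℕ) + 1, hj⟩ - x₀ j) (Fin.succ ⟨0, Nat.pos_of_ne_zero (NeZero.ne d)⟩)) :
    ∃ O ∈ 𝓝 x₀, ∀ F : 𝓢((Fin n → SpaceTime d), ℂ),
      HasCompactSupport (F : (Fin n → SpaceTime d) → ℂ) →
      tsupport (F : (Fin n → SpaceTime d) → ℂ) ⊆ O →
        T F = T (permTest (Equiv.swap j ⟨(j : ℕ) + 1, hj⟩) F) := by
  -- indices and the swap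
  set i₀ : Fin d := ⟨0, Nat.pos_of_ne_zero (NeZero.ne d)⟩ with hi₀
  set j' : Fin n := ⟨(j : ℕ) + 1, hj⟩ with hj'def
  have hjj' : j ≠ j' := fun h => by have := congrArg Fin.val h; simp [hj'def] at this
  have hτinv : (Equiv.swap j j')⁻¹ = Equiv.swap j j' := Equiv.swap_inv _ _
  -- constants
  set μ₀ : ℝ := (x₀ j' - x₀ j) i₀.succ - |(x₀ j' - x₀ j) 0| with hμ₀
  have hμ₀pos : 0 < μ₀ := by rw [hμ₀]; linarith
  set ρ : ℝ := μ₀ / 8 with hρ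
  have hρpos : 0 < ρ := by positivity
  set Rx : ℝ := ‖x₀‖ + ρ with hRx
  have hRxpos : 0 < Rx := by positivity
  set κ₁ : ℝ := 1 / (2 * ((n : ℝ) + 3)) with hκ₁
  have hκ₁pos : 0 < κ₁ := by positivity
  have hκ₁n : κ₁ * ((n : ℝ) + 3) < 1 := by
    rw [hκ₁, div_mul_eq_mul_div, one_mul, div_lt_one (by positivity)]; linarith
  set c : ℝ := min 1 (κ₁ / (8 * (2 * Rx + 1))) with hc
  have hcpos : 0 < c := lt_min one_pos (by positivity)
  have hc1 : c ≤ 1 := min_le_left _ _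
  have hcA : 2 * c * (2 * Rx) ≤ κ₁ / 4 := by
    have h1 : c ≤ κ₁ / (8 * (2 * Rx + 1)) := min_le_right _ _
    have hA0 : 0 ≤ 2 * Rx := by positivity
    calc 2 * c * (2 * Rx) ≤ 2 * (κ₁ / (8 * (2 * Rx + 1))) * (2 * Rx) := by gcongr
      _ = κ₁ / 4 * (2 * Rx / (2 * Rx + 1)) := by field_simp; ring
      _ ≤ κ₁ / 4 * 1 := by
          gcongr
          rw [div_le_one (by positivity)]; linarith
      _ = κ₁ / 4 := mul_one _
  set κ₂ : ℝ := c * μ₀ / 48 with hκ₂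
  have hκ₂pos : 0 < κ₂ := by positivity
  set γ : ℝ := min (1 / 2) (κ₁ / 8) with hγ
  have hγpos : 0 < γ := lt_min (by norm_num) (by positivity)
  have hγhalf : γ ≤ 1 / 2 := min_le_left _ _
  have hγ1 : γ ≤ 1 := hγhalf.trans (by norm_num)
  have hγκ : 2 * γ ≤ κ₁ / 4 := by have := min_le_right (1 / 2 : ℝ) (κ₁ / 8); linarith
  set κ₃ : ℝ := min (κ₁ / 2) (c * μ₀ / 8) with hκ₃
  have hκ₃pos : 0 < κ₃ := lt_min (by positivity) (by positivity)
  set L : ℝ := 1 + κ₂ with hL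
  have hLpos : 0 < L := by positivity
  set ε : ℝ := κ₂ / 2 with hε
  have hεpos : 0 < ε := by positivity
  have hεL : ε < L := by rw [hε, hL]; linarith
  have hεκL : ε < κ₂ * L := by rw [hε, hL]; nlinarith
  -- the directions
  have hηpΓ : etaDir d n j' L ε ∈ tubeCone d n := etaDir_mem_tubeCone j' hLpos hεpos
  have hηmτΓ : (fun k => etaDir d n j' L (-ε) (Equiv.swap j j' k)) ∈ tubeCone d n :=
    etaDir_comp_swap_mem_tubeCone j hj hLpos hεpos hεL
  have hηpΓ' : etaDir d n j' L ε ∈ localCone n j' j κ₁ κ₂ :=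
    etaDir_mem_localCone hjj' hLpos hκ₁pos hκ₁n
      (by rw [abs_of_pos hεpos]; exact hεκL) (by rw [hε, hL, abs_le]; constructor <;> linarith)
  have hηmΓ' : etaDir d n j' L (-ε) ∈ localCone n j' j κ₁ κ₂ :=
    etaDir_mem_localCone hjj' hLpos hκ₁pos hκ₁n
      (by rw [abs_neg, abs_of_pos hεpos]; exact hεκL)
      (by rw [hε, hL, abs_le]; constructor <;> linarith)
  -- the key geometric statement and its consequences
  have key : ∀ x ∈ ball x₀ ρ, ∀ y ∈ localCone n j' j κ₁ κ₂, ‖y‖ < γ → ∀ k,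
      κ₃ * ‖y‖ ≤ coneMargin (imPart (succDiff (boostConfig n i₀ (((c * ‖y‖ : ℝ) : ℂ) * I)
        (fun k => complexifyPoint (x k) + (I : ℂ) • complexifyPoint (y k))) k)) :=
    fun x hx y hy hyγ k => boost_margin_of_mem_localCone i₀ j hj hμ₀ hμ₀pos (by rw [hρ]; linarith)
      le_rfl hcpos.le hc1 hcA hγ1 hγκ hκ₂ hκ₂pos.le (min_le_left _ _) (min_le_right _ _) hx hy hyγ k
  have hΓ'0 : (0 : Fin n → SpaceTime d) ∉ localCone n j' j κ₁ κ₂ := zero_notMem_localCone hjj'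
  have key_mem : ∀ x ∈ ball x₀ ρ, ∀ y ∈ localCone n j' j κ₁ κ₂, ‖y‖ < γ →
      boostConfig n i₀ (((c * ‖y‖ : ℝ) : ℂ) * I)
        (fun k => complexifyPoint (x k) + (I : ℂ) • complexifyPoint (y k)) ∈ forwardTube d n := by
    intro x hx y hy hyγ k
    have hy0 : 0 < ‖y‖ := norm_pos_iff.2 fun h => hΓ'0 (h ▸ hy)
    exact (mem_forwardCone_iff_coneMargin_pos _).2
      ((mul_pos hκ₃pos hy0).trans_le (key x hx y hy hyγ k))
  have key_ray : ∀ x ∈ ball x₀ ρ, ∀ y ∈ localCone n j' j κ₁ κ₂, ‖y‖ < γ →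
      ∃ (x' η' : Fin n → SpaceTime d), ‖x'‖ ≤ 3 * Rx + 2 ∧ (∀ k, κ₃ ≤ coneMargin (succDiff η' k)) ∧
        ‖η'‖ ≤ 3 + 2 * Rx ∧
        boostConfig n i₀ (((c * ‖y‖ : ℝ) : ℂ) * I)
          (fun k => complexifyPoint (x k) + (I : ℂ) • complexifyPoint (y k)) =
          fun k => complexifyPoint (x' k) + ((‖y‖ : ℂ) * I) • complexifyPoint (η' k) := by
    intro x hx y hy hyγ
    have hnx : ‖x‖ ≤ Rx := by
      have h1 := norm_le_norm_add_norm_sub' x x₀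
      have h2 : ‖x - x₀‖ < ρ := by rwa [mem_ball, dist_eq_norm] at hx
      rw [hRx]; linarith
    have hy0 : 0 < ‖y‖ := norm_pos_iff.2 fun h => hΓ'0 (h ▸ hy)
    exact boost_point_ray i₀ hcpos.le hc1 hnx hy0 (hyγ.le.trans hγ1) (key x hx y hy hyγ)
  -- conclusion
  refine ⟨ball x₀ ρ, ball_mem_nhds _ hρpos, fun F hFc hFO => ?_⟩
  exact apply_permTest_eq_of_localTube hE1 hE3 h𝔚 hbv hS hgrowth hBHW i₀ hτinv isOpen_localCone
    (convex_localCone hκ₁pos.le hκ₂pos.le) (fun s hs y hy => smul_mem_localCone hy hs) hΓ'0 hγpos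
    hγhalf hκ₃pos key_mem key_ray hηpΓ hηpΓ' hηmΓ' hηmτΓ F hFc hFO

end Main

end Literature.MathematicalPhysics.QuantumFieldTheory
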